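import Literature.Analysis.FluidPDE.TorusNSSobolevControlInequality
import Literature.Analysis.FunctionSpaces.TorusSpaceTimeComposition
import Literature.Analysis.FunctionSpaces.CubicLatticeInversePowerSums
import HarnessLib

/-!
# Lifespan, global existence and global stability from Morosi–Pizzocchero's `Ḣ^s` control
# inequality on `T³`: the global form of MP 2015 Prop. 4.4 (i), the zero approximate solution
# (Prop. 5.1), Pizzocchero's global stability theorem (2021, Thm. 5.1) and its generalized
# Beltrami / shear-flow instances (2021, §6)

Analysis/FluidPDE support file (theorems only; no definitions, no named facts); the sequel of
`TorusNSSobolevControlInequality` (that file is at its size cap). Search for candidate a priori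
estimates; no regularity claim.

Morosi–Pizzocchero, *Nonlinear Anal.* 113 (2015) 298–308 (arXiv:1405.3421):

* Prop. 4.4 (i), last sentence: "In particular, if `R_n` is global (`T_c = +∞`) then `u` is global
  as well (`T = +∞`)." Here: `Torus.classicalNS_global_of_sobolev_control_kernels` — the global
  form of `Torus.classicalNS_regular_of_sobolev_control_kernels` (the control inequality
  `R' ≥ −4π²νR + (G·D₀ + K·D₁)R + G·R² + E`, `G = 2π√Gsq`, `K = 2π√Ksq`, with MP's lattice
  functionals `𝒢_s`, `𝒦_s` bounded by the hypotheses `hGker`, `hKker`, on `[0, ∞)`).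
* §5, Prop. 5.1 (the zero approximate solution `u_a := 0`; extending Prop. 5.2 of
  Morosi–Pizzocchero, *Nonlinear Anal.* 75 (2012) 2209): "Consider the Cauchy problem for the NS
  equations with viscosity `ν`, zero forcing and any datum `u₀ ∈ H^∞_{Σ0}`; let `u` denote its
  maximal solution. After fixing a real `n > d/2 + 1`, put
  `T_c := +∞` if `‖u₀‖_n ≤ ν/G_n`, `T_c := −ν^{−1} log(1 − ν/(G_n‖u₀‖_n))` otherwise (intending
  `1/(G_n‖u₀‖_n)` if `ν = 0`). Then `T ≥ T_c` and
  `‖u(t)‖_n ≤ ‖u₀‖_n e^{−νt} / (1 − G_n‖u₀‖_n e_ν(t))`, `e_ν(t) := (1 − e^{−νt})/ν`, on `[0, T_c)`.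
  (So, if `‖u₀‖_n ≤ ν/G_n`, `u` is global and its norm decays exponentially.)" Proof ibid.: the
  errors of `u_a = 0` are `𝒟_n = 𝒟_{n+1} = ε_n = 0`, `δ_n = ‖u₀‖_n`; the control inequality taken
  as the equality `Ṙ = −νR + G_nR²`, `R(0) = ‖u₀‖_n`, has the displayed maximal solution.
  Here, on the unit torus `T³` with `‖w‖_s² := ∑_k |k|^{2s}‖ŵ(k)‖²` (so MP's `−νR` reads `−4π²νR`
  and `G_n` reads `G := 2π√Gsq`), `μ := 4π²ν`, `R₀ := ‖u₀‖_s`: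
  `Torus.classicalNS_regular_of_hsNorm_kernels` — if `G R₀ (1 − e^{−μT}) < μ` (i.e. `T < T_c`) the
  classical solution from `u₀` exists on `[0, T]` with
  `‖u(t)‖_s ≤ R₀e^{−μt}/(1 − G R₀ (1 − e^{−μt})/μ)`;
  `Torus.classicalNS_regular_of_hsNorm_mul_lt_one_kernels` — the `ν`-independent sufficient
  condition `G R₀ T < 1` (`1 − e^{−μT} ≤ μT`; MP's `T_c ≥ 1/(G_n‖u₀‖_n)`);
  `Torus.classicalNS_global_of_hsNorm_kernels` — `G R₀ ≤ μ` gives a GLOBAL classical solution with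
  the same bound for all `t ≥ 0` (exponential decay of `‖u(t)‖_s`);
  and at `n = 3` with the tree's hypothesis-free Kato constant `G = 2π(24ζ₄)^{1/2} ≈ 125`
  (`NSSobolev.sum_gramKernel_le_three`; `ζ₄ = ∑_{k≠0}|k|^{−4} ≈ 16.5`; MP's certified value on
  `(ℝ/2πℤ)³` reads `≈ 43` in this normalisation):
  `Torus.classicalNS_regular_of_hsNorm_three` (`2π(24ζ₄)^{1/2}‖u₀‖₃ T < 1 ⇒` classical on
  `[0, T]`) and `Torus.classicalNS_global_of_hsNorm_three` (`2π(24ζ₄)^{1/2}‖u₀‖₃ ≤ 4π²ν ⇒` global,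
  `‖u(t)‖₃ ≤ ‖u₀‖₃e^{−4π²νt}/(1 − G‖u₀‖₃(1 − e^{−4π²νt})/(4π²ν))`).

The transport functional `𝒦_s` multiplies `𝒟_{n+1} = 0` here; it is discharged by
`NSSobolev.sum_wedgeKernel_le_mpp` (`2s > 3`), so only `hGker` (or nothing, at `s = 3`) remains.

L. Pizzocchero, *Appl. Math. Lett.* 115 (2021) 106970, Thm. 5.1 (global stability): "Let
`v₀ ∈ E^∞` [data of global, decaying solutions]. Denote with `v` the global, decaying NS solution
with initial datum `v₀`, and set `J_p := ∫₀^{+∞} dt ‖v(t)‖_p < +∞`; choose any `n ∈ (d/2 + 1, +∞)`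
and define `ρ_n := (ν/G_n) e^{−G_nJ_n − K_nJ_{n+1}}`. Then `u₀ ∈ H^∞_{Σ0}`, `‖u₀ − v₀‖_n < ρ_n ⟹
u₀ ∈ E^∞`. If moreover `u` is the global, decaying NS solution with datum `u₀`, for all `t ≥ 0`,
`‖u(t) − v(t)‖_n ≤ e^{G_nJ_n + K_nJ_{n+1}} δ_n e^{−νt}/(1 − δ_n/ρ_n)`, `δ_n := ‖u₀ − v₀‖_n`" (plus
`p > n` bounds). Proof ibid. (5.6)–(5.17): Prop. 3.2 (= MP 2015 Prop. 4.4) with `u_a := v`, the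
control equation `Ṙ_n = −νR_n + (G_n‖v‖_n + K_n‖v‖_{n+1})R_n + G_nR_n²` solved explicitly,
`T_c = +∞` iff `δ_n < ρ_n`. Here (§4): `Torus.classicalNS_global_stability_kernels` — `v` a global
classical solution with envelopes `D₀ ≥ ‖v‖_s`, `D₁ ≥ ‖v‖_{s+1}` and an antiderivative `Λ` of
`2π√Gsq·D₀ + 2π√Ksq·D₁` bounded by `L` (the rôle of `G_nJ_n + K_nJ_{n+1}`); if
`2π√Gsq·‖u₀ − v(0)‖_s·e^{L} < 4π²ν` (i.e. `δ < ρ = (4π²ν/G)e^{−L}`) the solution from `u₀` is global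
with `‖u(t) − v(t)‖_s ≤ δe^{Λ(t)−4π²νt}/(1 − Gδe^{L}(1 − e^{−4π²νt})/(4π²ν))`;
`Torus.classicalNS_global_stability_kernels'` — the printed bound
`≤ e^{L}δe^{−4π²νt}/(1 − δ/ρ)`; `Torus.classicalNS_global_stability_three` — `n = 3` with the
hypothesis-free `G ≈ 125`, `K ≈ 83`; `Torus.classicalNS_global_stability_of_exp_decay` (and
`…_three`) — the case `‖v(t)‖_s ≤ M₀e^{−λt}`, `‖v(t)‖_{s+1} ≤ M₁e^{−λt}`: `L = (G M₀ + K M₁)/λ`,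
radius `(4π²ν/G)e^{−L}`. (Ibid. §6: for a generalized Beltrami datum, `Δv₀ = −κ²v₀`,
`v(t) = e^{−νκ²t}v₀` and `ρ_n = (ν/G_n)exp(−(G_n + K_nκ)κ^{n−2}‖v₀‖_{L²}/ν)` — exactly this shape.)
§5 types that instance abstractly: `Torus.isClassicalNSSolutionOn_expDecay_of_eigen` — for a smooth
divergence-free `w` with `Δw = −c w` and `(w·∇)w = ∇θ` (ibid. (6.1): "generalized Beltrami flow";
Beltrami fields `θ = |w|²/2`, shear fields `A sin(2πk·x)`, `A·k = 0`, `θ = 0`), `v(t) = e^{−νct}w`,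
`q(t) = −e^{−2νct}θ` is a global classical solution of the unforced equations ((6.3)); and
`Torus.classicalNS_global_stability_of_eigen_three` — its global stability in `Ḣ³` with the
explicit radius `(4π²ν/G)e^{−L}`, `L = (G‖w‖₃ + K‖w‖₄)/(νc)` ((6.5) with the tree constants).
§6 types the concrete trigonometric datum of ibid. (6.6)–(6.7),
"`v₀(x) := (√2/(2π)^{d/2}) A sin(k·x)` (`A ∈ ℝ^d`, `k ∈ ℤ^d ∖ {0}`, `A·k = 0`) (`div v₀ = 0` due to
`A·k = 0`; `P(v₀, v₀) = −𝓛((v₀·∇)v₀)` vanishes because `((v₀·∇)v₀)(x) = (2π)^{−d}(A·k)A sin(2k·x) = 0`).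
In the present case `κ = |k|`, `‖v₀‖_{L²} = |A|`, `‖v₀‖_p = |k|^p|A|` for all `p ∈ ℝ`. So, for each real
`p`, `‖v₀‖_p` can be arbitrarily large", on the unit torus as the single real mode
`w = Re (e_k z)` = `Torus.realTrigPoly {k} (fun _ => z)` with a transversal vector `z ∈ ℂ^d`,
`k · z = 0` (`z = −iA` gives `sin(2πk·x) A = (Im e_k) • A`,
`Torus.realTrigPoly_singleton_neg_I_smul_complexify`): `k · w(x) = 0` pointwise, hence
`(w·∇)w = 0` (`Torus.convect_realTrigPoly_singleton_self_eq_zero`; with `Δw = −4π²|k|²w`,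
`Torus.laplacian_realTrigPoly_singleton`, and `div w = 0`, `Torus.isDivFree_realTrigPoly_singleton`,
of `TorusFourierModes`); `‖w‖_s = |k|^s‖z‖/√2` for `k ≠ 0`
(`Torus.sqrt_tsum_rpow_mul_norm_sq_mFourierCoeff_realTrigPoly_singleton`, (6.7));
`v(t) = e^{−4π²|k|²νt}w` with zero pressure is a classical solution on `[0, ∞)` for every `ν`
(`Torus.isClassicalNSSolutionOn_expDecay_realTrigPoly_singleton`, `Torus.isClassicalNSSolutionOn_shearWave`,
(6.3)); and on `T³` its global stability in `Ḣ³` with `L = (G + K|k|)|k|‖z‖/(4√2π²ν)`, any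
amplitude (`Torus.classicalNS_global_stability_realTrigPoly_singleton_three`,
`Torus.classicalNS_global_stability_shearWave_three`; Thm. 5.1 with (6.5)).
§7 inserts the kernel-certified lattice sums of `FunctionSpaces/CubicLatticeInversePowerSums`
(`ζ₄(ℤ³) = ∑'_{k≠0}|k|⁻⁴ ≤ 16.6213`, `ζ₆(ℤ³) ≤ 8.4034`; Jones–Ingham 1925, Table I: `16.5323`,
`8.40192`): `Torus.katoConst_three_le` (`G = 2π(24ζ₄)^{1/2} ≤ 125.5`), `Torus.transportConst_three_le`
(`K = 2π(B₃ζ₆)^{1/2} ≤ 83.5`, `B₃ = 2⁸4⁴/5⁵`), and the numeric forms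
`Torus.classicalNS_regular_of_hsNorm_three_numeric` (`125.5‖u₀‖₃T < 1`),
`Torus.classicalNS_global_of_hsNorm_three_numeric` (`125.5‖u₀‖₃ ≤ 4π²ν`) and
`Torus.classicalNS_global_stability_shearWave_three_numeric`
(`125.5 δ exp((125.5|k|³ + 83.5|k|⁴)‖A‖/(4√2π²|k|²ν)) < 4π²ν`) and the `|k| = 1` row
`Torus.classicalNS_global_stability_shearWave_three_unit` (`125.5 δ exp(209‖A‖/(4√2π²ν)) < 4π²ν`).

Beyond-source declarations (proved here; not statements printed in the cited texts — index line
requested by the cell, L-φ-1): `Torus.classicalNS_regular_of_hsNorm_mul_lt_one_kernels` (one-line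
corollary of Prop. 5.1's `T_c`), `Torus.classicalNS_global_stability_of_exp_decay(_three)` and
`Torus.classicalNS_global_stability_of_eigen_three` (instantiations of Thm. 5.1 in the shape of
§6 ibid.), every `_three` form (instantiation with the tree's hypothesis-free constants of
`TorusNSKatoPairInequality` §6–§7, which are themselves beyond-source evaluations), and in §6 the
instantiations `Torus.classicalNS_global_stability_realTrigPoly_singleton_three` /
`Torus.classicalNS_global_stability_shearWave_three` (Thm. 5.1 at the datum (6.6) with the tree
constants), the closed form of `‖w‖_s` and the identification `Re (e_k (−iA)) = sin(2πk·x) A`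
(elementary evaluations at the printed datum; the single-mode plumbing `k · w = 0`, `(u·∇)w = 0`
for `k · u = 0` is private), and in §7 the numeric instantiations (`…_numeric`, `…_unit`, `Torus.katoConst_three_le`,
`Torus.transportConst_three_le`: the cited statements with the certified lattice sums inserted).
Relation to the tree: `TorusNSSobolevHighRange` has the Robinson–Sadowski–Silva window/rate form of
the `Ḣ^s` lifespan for `s > 5/2` (scaling-sharp in `‖u₀‖₂`, `‖u₀‖_{Ḣ^s}`, along a given solution);
`TorusNSSmallDataGlobal` has small-data global existence in `L³`, `Ḣ^{1/2}` and enstrophy. The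
present statements are MP's closed forms with the explicit Kato constant, existence included.
Stated for the special case we need (classical solutions on the unit `T³`, zero forcing);
-- TODO(general form): MP allow any `n > d/2 + 1` on `(ℝ/2πℤ)^d`, the `p > n` estimates (5.3) via
Prop. 4.4 (ii), and nonzero forcing (Remark 5.2 (ii)); Pizzocchero 2021 also concludes the decay
of `u` (`u₀ ∈ E^∞`) and the `p > n` bounds; of §6 ibid. only the shear example (6.6) and the
abstract class (6.1) are typed — a Beltrami datum proper (`rot v₀ = ±κv₀`, footnote 8 ibid.) needs
the Lamb identity `(v·∇)v = (rot v) ∧ v + ∇(|v|²/2)` on the torus, not available in this cone.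

## References
* C. Morosi, L. Pizzocchero, Nonlinear Anal. 113 (2015) 298–308 (arXiv:1405.3421), Prop. 4.4 (i),
  §5 Prop. 5.1, Remark 5.2. [MorosiPizzocchero2015]
* L. Pizzocchero, Appl. Math. Lett. 115 (2021) 106970 (doi:10.1016/j.aml.2020.106970), Prop. 3.2,
  Thm. 5.1, §6 (6.1)–(6.7). [Pizzocchero2021]
* C. Morosi, L. Pizzocchero, Nonlinear Anal. 75 (2012) 2209–2235 (arXiv:1104.3832), Prop. 5.2.
  [MorosiPizzocchero2012Approx]
* C. Morosi, L. Pizzocchero, Commun. Pure Appl. Anal. 11 (2012) 557–586 (arXiv:1009.2051),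
  Prop. 3.5, Lemma 5.3. [MorosiPizzocchero2012Kato]
* C. Morosi, L. Pizzocchero, Appl. Math. Lett. 26 (2013) 277–284 (arXiv:1007.4412), Prop. 3.7.
  [MorosiPizzocchero2013Basic]
* C. Morosi, M. Pernici, L. Pizzocchero, Appl. Math. Comput. 308 (2017) 54–72
  (arXiv:1511.00533), Lemma 5.3. [MorosiPerniciPizzocchero2017]
* J. E. Jones, A. E. Ingham, Proc. R. Soc. Lond. A 107 (1925) 636–653, Table I (simple cubic
  lattice sums `A₄ = 16.5323`, `A₆ = 8.40192`). [JonesIngham1925]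
-/

noncomputable section

open MeasureTheory Set Filter UnitAddTorus Function Finset
open scoped Topology BigOperators InnerProductSpace ComplexConjugate

namespace Literature.Analysis.FluidPDE

section Lifespan

open Literature.Analysis.FunctionSpaces Literature.Analysis.FunctionSpaces.Torus NSSobolev NSGevrey

variable {d : Type*} [Fintype d] [DecidableEq d]

/-! ### §1 The global form of MP Prop. 4.4 (i) with the lattice functionals -/

/-- **"If `R_n` is global then `u` is global", in Morosi–Pizzocchero's shape** (MP 2015, Prop. 4.4
(i): "In particular, if `R_n` is global (`T_c = +∞`) then `u` is global as well (`T = +∞`)";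
`Torus.classicalNS_global_of_sobolev_control` with the control inequality of
`Torus.classicalNS_regular_of_sobolev_control_kernels`): the hypotheses on `[0, ∞)` —
`R' ≥ −4π²νR + (2π√Gsq·D₀ + 2π√Ksq·D₁)R + 2π√Gsq·R² + E` at every `t ≥ 0`, `R(0) ≥ ‖u₀ − v(0)‖_s` —
give a GLOBAL classical solution from `u₀` with `‖u(t) − v(t)‖_s ≤ R(t)` for all `t ≥ 0`.
[cite: MorosiPizzocchero2015, Prop. 4.4 (i) (global case); MorosiPizzocchero2012Kato, Prop. 3.5; MorosiPizzocchero2013Basic, Prop. 3.7] -/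
theorem Torus.classicalNS_global_of_sobolev_control_kernels (hd : Fintype.card d = 3) {ν : ℝ}
    (hν : 0 < ν) {s : ℝ} (hs : 1 ≤ s)
    {Gsq : ℝ} (hGker : ∀ (k : d → ℤ) (H : Finset (d → ℤ)), ∑ h ∈ H,
      (freqNormSq h * freqNormSq k - (∑ j, (h j : ℝ) * (k j : ℝ)) ^ 2) *
        (freqNormSq k ^ (s / 2) - freqNormSq (k - h) ^ (s / 2)) ^ 2 /
        (freqNormSq h ^ (s + 1) * freqNormSq (k - h) ^ s) ≤ Gsq)
    {Ksq : ℝ} (hKker : ∀ (k : d → ℤ) (H : Finset (d → ℤ)), ∑ h ∈ H,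
      freqNormSq k ^ s * (freqNormSq h * freqNormSq k - (∑ j, (h j : ℝ) * (k j : ℝ)) ^ 2) /
        (freqNormSq h ^ (s + 1) * freqNormSq (k - h) ^ (s + 1)) ≤ Ksq)
    {v g : ℝ → UnitAddTorus d → EuclideanSpace ℝ d} {q : ℝ → UnitAddTorus d → ℝ}
    (hv : Torus.IsClassicalNSSolutionOn (Ici 0) ν g v q)
    (hmv : ∀ t ∈ Ici (0 : ℝ), Torus.HasZeroMean (v t))
    {D₀ D₁ E : ℝ → ℝ} (hD₀c : ContinuousOn D₀ (Ici 0)) (hD₁c : ContinuousOn D₁ (Ici 0))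
    (hD₀ : ∀ t ∈ Ici (0 : ℝ), Real.sqrt (∑' k : d → ℤ, freqNormSq k ^ s *
      ‖mFourierCoeff (EuclideanSpace.complexify ∘ v t) k‖ ^ 2) ≤ D₀ t)
    (hD₁ : ∀ t ∈ Ici (0 : ℝ), Real.sqrt (∑' k : d → ℤ, freqNormSq k ^ (s + 1) *
      ‖mFourierCoeff (EuclideanSpace.complexify ∘ v t) k‖ ^ 2) ≤ D₁ t)
    (hE : ∀ t ∈ Ici (0 : ℝ), Real.sqrt (∑' k : d → ℤ, freqNormSq k ^ s *
      ‖mFourierCoeff (EuclideanSpace.complexify ∘ g t) k‖ ^ 2) ≤ E t)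
    {u₀ : UnitAddTorus d → EuclideanSpace ℝ d} (hu₀ : Torus.IsSmooth u₀)
    (hdiv : Torus.IsDivFree u₀) (hmean : Torus.HasZeroMean u₀)
    {R R' : ℝ → ℝ} (hRc : ContinuousOn R (Ici 0))
    (hRd : ∀ t ∈ Ici (0 : ℝ), HasDerivWithinAt R (R' t) (Ici t) t)
    (hRge : ∀ t ∈ Ici (0 : ℝ),
      -(4 * Real.pi ^ 2 * ν) * R t +
        (2 * Real.pi * Real.sqrt Gsq * D₀ t + 2 * Real.pi * Real.sqrt Ksq * D₁ t) * R t +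
        2 * Real.pi * Real.sqrt Gsq * R t ^ 2 + E t ≤ R' t)
    (hR0 : Real.sqrt (∑' k : d → ℤ, freqNormSq k ^ s *
      ‖mFourierCoeff (EuclideanSpace.complexify ∘ (fun y => u₀ y - v 0 y)) k‖ ^ 2) ≤ R 0) :
    ∃ (u : ℝ → UnitAddTorus d → EuclideanSpace ℝ d) (p : ℝ → UnitAddTorus d → ℝ),
      Torus.IsClassicalNSSolutionOn (Ici 0) ν 0 u p ∧ u 0 = u₀ ∧
      (∀ t ∈ Ici (0 : ℝ), Torus.HasZeroMean (u t)) ∧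
      ∀ t ∈ Ici (0 : ℝ), Real.sqrt (∑' k : d → ℤ, freqNormSq k ^ s *
        ‖mFourierCoeff (EuclideanSpace.complexify ∘ (fun y => u t y - v t y)) k‖ ^ 2) ≤ R t := by
  -- the closed-window theorem on `[0, T]` for every `T > 0`
  have hwin : ∀ {T : ℝ}, 0 < T →
      ∃ (u : ℝ → UnitAddTorus d → EuclideanSpace ℝ d) (p : ℝ → UnitAddTorus d → ℝ),
        Torus.IsClassicalNSSolutionOn (Icc 0 T) ν 0 u p ∧ u 0 = u₀ ∧
        (∀ t ∈ Icc 0 T, Torus.HasZeroMean (u t)) ∧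
        ∀ t ∈ Icc 0 T, Real.sqrt (∑' k : d → ℤ, freqNormSq k ^ s *
          ‖mFourierCoeff (EuclideanSpace.complexify ∘ (fun y => u t y - v t y)) k‖ ^ 2) ≤ R t := by
    intro T hT
    have hsub : Icc 0 T ⊆ Ici 0 := fun t ht => mem_Ici.2 ht.1
    exact Torus.classicalNS_regular_of_sobolev_control_kernels hd hν hT hs hGker hKker
      (hv.mono hsub (uniqueDiffOn_Icc hT)) (fun t ht => hmv t (hsub ht)) (hD₀c.mono hsub)
      (hD₁c.mono hsub) (fun t ht => hD₀ t (hsub ht)) (fun t ht => hD₁ t (hsub ht))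
      (fun t ht => hE t (hsub ht)) hu₀ hdiv hmean (hRc.mono hsub)
      (fun t ht => hRd t (mem_Ici.2 ht.1)) (fun t ht => hRge t (mem_Ici.2 ht.1)) hR0
  obtain ⟨u, p, hu0, hcases⟩ := Torus.exists_maximal_classicalNS hd hν hu₀ hdiv hmean
  rcases hcases with ⟨hU, hmU, huniq⟩ | ⟨Tu, hTu, -, -, -, huniq⟩
  · refine ⟨u, p, hU, hu0, fun t ht => hmU t (mem_Ici.1 ht), fun t ht => ?_⟩
    rcases eq_or_lt_of_le (mem_Ici.1 ht) with h0t | h0t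
    · rw [← h0t, hu0]; exact hR0
    · obtain ⟨u', p', hu', hu'0, -, hb'⟩ := hwin h0t
      have heq : u' t = u t := huniq t u' p' hu' hu'0 t (right_mem_Icc.2 h0t.le)
      have h := hb' t (right_mem_Icc.2 h0t.le)
      rwa [heq] at h
  · -- a finite blow-up time contradicts the closed-window theorem on `[0, Tu]`
    exfalso
    obtain ⟨u', p', hu', hu'0, -, -⟩ := hwin hTu
    exact (lt_irrefl Tu) (huniq Tu u' p' hu' hu'0).1

/-! ### §2 The zero approximate solution (MP 2015 Prop. 5.1) -/


/-- The rest state `u ≡ 0`, `p ≡ 0` is a classical solution of the unforced system on every time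
set (as in `TorusClassicalNSMaximalSolution`, whose copy is private). [folklore] -/
private theorem za_restState (S : Set ℝ) (ν : ℝ) :
    Torus.IsClassicalNSSolutionOn S ν (0 : ℝ → UnitAddTorus d → EuclideanSpace ℝ d) 0 0 where
  smooth_velocity := by
    unfold Torus.IsSmoothSpaceTimeOn
    exact contDiffOn_const
  smooth_pressure := by
    unfold Torus.IsSmoothSpaceTimeOn
    exact contDiffOn_const
  momentum t _ x := by
    have hs : Torus.IsSmooth (0 : UnitAddTorus d → EuclideanSpace ℝ d) := contDiff_const
    have h1 : Torus.timeDerivWithin S (0 : ℝ → UnitAddTorus d → EuclideanSpace ℝ d) t x = 0 := by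
      simp [Torus.timeDerivWithin]
    have h2 : Torus.convect ((0 : ℝ → UnitAddTorus d → EuclideanSpace ℝ d) t)
        ((0 : ℝ → UnitAddTorus d → EuclideanSpace ℝ d) t) x = 0 := by
      show Torus.fderiv (0 : UnitAddTorus d → EuclideanSpace ℝ d) x
        ((0 : UnitAddTorus d → EuclideanSpace ℝ d) x) = 0
      rw [Pi.zero_apply, map_zero]
    have hpd : ∀ i : d, Torus.partialDeriv i (0 : UnitAddTorus d → EuclideanSpace ℝ d) =
        fun _ => 0 := fun i => by
      funext y
      simp [Torus.partialDeriv, Torus.lineDeriv]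
    have h3 : Torus.laplacian ((0 : ℝ → UnitAddTorus d → EuclideanSpace ℝ d) t) x = 0 := by
      show Torus.laplacian (0 : UnitAddTorus d → EuclideanSpace ℝ d) x = 0
      rw [Torus.laplacian_eq_sum_partialDeriv_partialDeriv hs x]
      refine Finset.sum_eq_zero fun i _ => ?_
      rw [hpd i]
      simp [Torus.partialDeriv, Torus.lineDeriv]
    have h4 : Torus.gradient ((0 : ℝ → UnitAddTorus d → ℝ) t) x = 0 := by
      show _root_.gradient (fun _ : EuclideanSpace ℝ d => (0 : ℝ)) 0 = 0
      exact gradient_fun_const 0 0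
    rw [h1, h2, h3, h4]
    simp
  divFree t _ x := by
    simp [Torus.divergence, Torus.partialDeriv, Torus.lineDeriv]

omit [DecidableEq d] in
/-- The `Ḣ^s` functional of the zero field vanishes. [folklore] -/
private theorem za_sqrt_tsum_zero (s t : ℝ) :
    Real.sqrt (∑' k : d → ℤ, freqNormSq k ^ s *
      ‖mFourierCoeff (EuclideanSpace.complexify ∘
        (0 : ℝ → UnitAddTorus d → EuclideanSpace ℝ d) t) k‖ ^ 2) = 0 := by
  have e : (⇑(EuclideanSpace.complexify (ι := d)) ∘
      (0 : ℝ → UnitAddTorus d → EuclideanSpace ℝ d) t) = 0 := by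
    funext x; simp
  have h : ∀ k : d → ℤ, mFourierCoeff (0 : UnitAddTorus d → EuclideanSpace ℂ d) k = 0 :=
    fun k => by
    rw [mFourierCoeff_eq_integral_volume]
    simp
  rw [e]
  simp [h]

/-- **The control function of the zero approximate solution** (MP 2015, proof of Prop. 5.1: the
maximal solution of `Ṙ = −νR + G R²`, `R(0) = ‖u₀‖`): with `μ ≠ 0`,
`R(t) = R₀e^{−μt}/(1 − G R₀ (1 − e^{−μt})/μ)` satisfies `R' = −μR + G R²` wherever its
denominator does not vanish. [cite: MorosiPizzocchero2015, proof of Prop. 5.1] -/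
private theorem za_riccati_hasDerivAt {μ G R₀ : ℝ} (hμ : μ ≠ 0) {t : ℝ}
    (hφ : 1 - G * R₀ * (1 - Real.exp (-μ * t)) / μ ≠ 0) :
    HasDerivAt (fun τ => R₀ * Real.exp (-μ * τ) / (1 - G * R₀ * (1 - Real.exp (-μ * τ)) / μ))
      (-μ * (R₀ * Real.exp (-μ * t) / (1 - G * R₀ * (1 - Real.exp (-μ * t)) / μ)) +
        G * (R₀ * Real.exp (-μ * t) / (1 - G * R₀ * (1 - Real.exp (-μ * t)) / μ)) ^ 2) t := by
  have hlin : HasDerivAt (fun τ : ℝ => -μ * τ) (-μ) t := by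
    simpa using (hasDerivAt_id t).const_mul (-μ)
  have hE : HasDerivAt (fun τ => Real.exp (-μ * τ)) (Real.exp (-μ * t) * (-μ)) t := hlin.exp
  have hN : HasDerivAt (fun τ => R₀ * Real.exp (-μ * τ)) (R₀ * (Real.exp (-μ * t) * (-μ))) t :=
    hE.const_mul R₀
  have hD : HasDerivAt (fun τ => 1 - G * R₀ * (1 - Real.exp (-μ * τ)) / μ)
      (-(G * R₀ * (-(Real.exp (-μ * t) * (-μ))) / μ)) t :=
    (((hE.const_sub 1).const_mul (G * R₀)).div_const μ).const_sub 1
  have hφ' : μ - G * R₀ * (1 - Real.exp (-μ * t)) ≠ 0 := by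
    intro h
    apply hφ
    have : 1 - G * R₀ * (1 - Real.exp (-μ * t)) / μ =
        (μ - G * R₀ * (1 - Real.exp (-μ * t))) / μ := by
      field_simp
    rw [this, h, zero_div]
  refine (hN.div hD hφ).congr_deriv ?_
  field_simp
  ring

/-- **Morosi–Pizzocchero's Prop. 5.1 (the zero approximate solution), kernel form**: for a smooth
divergence-free mean-zero datum `u₀` on the unit torus (`card d = 3`, `ν > 0`, `s > 3/2`) and `Gsq`
bounding the partial sums of MP's Kato functional `𝒢_s(k)` (`hGker`), put `G = 2π√Gsq`,
`μ = 4π²ν`, `R₀ = ‖u₀‖_s = (∑|k|^{2s}‖û₀(k)‖²)^{1/2}`. If `G R₀ (1 − e^{−μT}) < μ` — i.e. `T` is below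
MP's `T_c = −μ^{−1} log(1 − μ/(G R₀))` when `G R₀ > μ`, and ANY `T > 0` when `G R₀ ≤ μ` — then the
classical solution from `u₀` exists on `[0, T]` and
`‖u(t)‖_s ≤ R₀e^{−μt}/(1 − G R₀(1 − e^{−μt})/μ)` there ("`T ≥ T_c`,
`‖u(t)‖_n ≤ ‖u₀‖_n e^{−νt}/(1 − G_n‖u₀‖_n e_ν(t))`, `e_ν(t) = (1 − e^{−νt})/ν`"). Proof as printed:
`Torus.classicalNS_regular_of_sobolev_control_kernels` with `u_a = 0` (errors `𝒟_n = 𝒟_{n+1} =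
ε_n = 0`, `δ_n = ‖u₀‖_n`) and the explicit solution of `Ṙ = −μR + G R²`; the transport functional
is discharged by `NSSobolev.sum_wedgeKernel_le_mpp` (it multiplies `𝒟_{n+1} = 0`). MP: `(ℝ/2πℤ)^d`,
any `n > d/2 + 1`, `H^∞` data; here `T³`, our normalisation (`−νR ↦ −4π²νR`, `G_n ↦ 2π√Gsq`).
[cite: MorosiPizzocchero2015, Prop. 5.1 with (5.2)–(5.3); MorosiPizzocchero2012Approx, Prop. 5.2] -/
theorem Torus.classicalNS_regular_of_hsNorm_kernels (hd : Fintype.card d = 3) {ν : ℝ}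
    (hν : 0 < ν) {T : ℝ} (hT : 0 < T) {s : ℝ} (hs : 3 / 2 < s)
    {Gsq : ℝ} (hGker : ∀ (k : d → ℤ) (H : Finset (d → ℤ)), ∑ h ∈ H,
      (freqNormSq h * freqNormSq k - (∑ j, (h j : ℝ) * (k j : ℝ)) ^ 2) *
        (freqNormSq k ^ (s / 2) - freqNormSq (k - h) ^ (s / 2)) ^ 2 /
        (freqNormSq h ^ (s + 1) * freqNormSq (k - h) ^ s) ≤ Gsq)
    {u₀ : UnitAddTorus d → EuclideanSpace ℝ d} (hu₀ : Torus.IsSmooth u₀)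
    (hdiv : Torus.IsDivFree u₀) (hmean : Torus.HasZeroMean u₀)
    (hTc : 2 * Real.pi * Real.sqrt Gsq * Real.sqrt (∑' k : d → ℤ, freqNormSq k ^ s *
      ‖mFourierCoeff (EuclideanSpace.complexify ∘ u₀) k‖ ^ 2) *
        (1 - Real.exp (-(4 * Real.pi ^ 2 * ν) * T)) < 4 * Real.pi ^ 2 * ν) :
    ∃ (u : ℝ → UnitAddTorus d → EuclideanSpace ℝ d) (p : ℝ → UnitAddTorus d → ℝ),
      Torus.IsClassicalNSSolutionOn (Icc 0 T) ν 0 u p ∧ u 0 = u₀ ∧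
      (∀ t ∈ Icc 0 T, Torus.HasZeroMean (u t)) ∧
      ∀ t ∈ Icc 0 T, Real.sqrt (∑' k : d → ℤ, freqNormSq k ^ s *
        ‖mFourierCoeff (EuclideanSpace.complexify ∘ u t) k‖ ^ 2) ≤
        Real.sqrt (∑' k : d → ℤ, freqNormSq k ^ s *
          ‖mFourierCoeff (EuclideanSpace.complexify ∘ u₀) k‖ ^ 2) *
          Real.exp (-(4 * Real.pi ^ 2 * ν) * t) /
          (1 - 2 * Real.pi * Real.sqrt Gsq * Real.sqrt (∑' k : d → ℤ, freqNormSq k ^ s *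
            ‖mFourierCoeff (EuclideanSpace.complexify ∘ u₀) k‖ ^ 2) *
            (1 - Real.exp (-(4 * Real.pi ^ 2 * ν) * t)) / (4 * Real.pi ^ 2 * ν)) := by
  classical
  have hn : (Fintype.card d : ℝ) = 3 := by rw [hd]; norm_num
  have hs1 : (1 : ℝ) ≤ s := by linarith
  have hsdK : (Fintype.card d : ℝ) < 2 * s := by rw [hn]; linarith
  set μ : ℝ := 4 * Real.pi ^ 2 * ν with hμ
  have hμ0 : 0 < μ := by rw [hμ]; positivity
  set G : ℝ := 2 * Real.pi * Real.sqrt Gsq with hG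
  have hG0 : 0 ≤ G := by rw [hG]; positivity
  set R₀ : ℝ := Real.sqrt (∑' k : d → ℤ, freqNormSq k ^ s *
    ‖mFourierCoeff (EuclideanSpace.complexify ∘ u₀) k‖ ^ 2) with hR₀
  have hR₀0 : 0 ≤ R₀ := Real.sqrt_nonneg _
  -- the denominator is positive on `[0, T]`
  set φ : ℝ → ℝ := fun t => 1 - G * R₀ * (1 - Real.exp (-μ * t)) / μ with hφ
  have hφpos : ∀ t ∈ Icc 0 T, 0 < φ t := by
    intro t ht
    have hexp : Real.exp (-μ * T) ≤ Real.exp (-μ * t) :=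
      Real.exp_le_exp.2 (by nlinarith [ht.2, hμ0])
    have h1 : G * R₀ * (1 - Real.exp (-μ * t)) ≤ G * R₀ * (1 - Real.exp (-μ * T)) :=
      mul_le_mul_of_nonneg_left (by linarith) (mul_nonneg hG0 hR₀0)
    have h2 : G * R₀ * (1 - Real.exp (-μ * T)) < μ := hTc
    have h3 : G * R₀ * (1 - Real.exp (-μ * t)) / μ < 1 := by
      rw [div_lt_one hμ0]; linarith
    show 0 < 1 - G * R₀ * (1 - Real.exp (-μ * t)) / μ
    linarith
  set R : ℝ → ℝ := fun t => R₀ * Real.exp (-μ * t) / φ t with hR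
  set R' : ℝ → ℝ := fun t => -μ * R t + G * R t ^ 2 with hR'
  -- the rest state as the approximate solution
  have hv : Torus.IsClassicalNSSolutionOn (Icc 0 T) ν
      (0 : ℝ → UnitAddTorus d → EuclideanSpace ℝ d) 0 0 := za_restState _ _
  have hmv : ∀ t ∈ Icc 0 T,
      Torus.HasZeroMean ((0 : ℝ → UnitAddTorus d → EuclideanSpace ℝ d) t) := by
    intro t _
    simp [Torus.HasZeroMean]
  have hD : ∀ (r : ℝ), ∀ t ∈ Icc 0 T, Real.sqrt (∑' k : d → ℤ, freqNormSq k ^ r *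
      ‖mFourierCoeff (EuclideanSpace.complexify ∘
        (0 : ℝ → UnitAddTorus d → EuclideanSpace ℝ d) t) k‖ ^ 2) ≤ (fun _ : ℝ => (0 : ℝ)) t :=
    fun r t _ => (za_sqrt_tsum_zero r t).le
  have hRc : ContinuousOn R (Icc 0 T) := by
    have hEc : Continuous fun t : ℝ => Real.exp (-μ * t) :=
      Real.continuous_exp.comp (continuous_const.mul continuous_id)
    have hNc : Continuous fun t : ℝ => R₀ * Real.exp (-μ * t) := continuous_const.mul hEc
    have hφc : Continuous φ :=
      continuous_const.sub ((continuous_const.mul (continuous_const.sub hEc)).div_const _)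
    exact hNc.continuousOn.div hφc.continuousOn fun t ht => (hφpos t ht).ne'
  have hRd : ∀ t ∈ Ico 0 T, HasDerivWithinAt R (R' t) (Ici t) t := by
    intro t ht
    have h := za_riccati_hasDerivAt (G := G) (R₀ := R₀) hμ0.ne'
      (hφpos t (Ico_subset_Icc_self ht)).ne'
    exact h.hasDerivWithinAt
  have hRge : ∀ t ∈ Ico 0 T,
      -(4 * Real.pi ^ 2 * ν) * R t +
        (2 * Real.pi * Real.sqrt Gsq * (fun _ : ℝ => (0 : ℝ)) t +
          2 * Real.pi * Real.sqrt (((2 : ℝ) ^ (2 * s + 2) * (s + 1) ^ (s + 1) / (s + 2) ^ (s + 2)) *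
            ∑' m : d → ℤ, (if m = 0 then (0 : ℝ) else freqNormSq m ^ (-s))) *
            (fun _ : ℝ => (0 : ℝ)) t) * R t +
        2 * Real.pi * Real.sqrt Gsq * R t ^ 2 + (fun _ : ℝ => (0 : ℝ)) t ≤ R' t := by
    intro t _
    show -(4 * Real.pi ^ 2 * ν) * R t + (2 * Real.pi * Real.sqrt Gsq * 0 +
      2 * Real.pi * Real.sqrt (((2 : ℝ) ^ (2 * s + 2) * (s + 1) ^ (s + 1) / (s + 2) ^ (s + 2)) *
        ∑' m : d → ℤ, (if m = 0 then (0 : ℝ) else freqNormSq m ^ (-s))) * 0) * R t +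
      2 * Real.pi * Real.sqrt Gsq * R t ^ 2 + 0 ≤ -μ * R t + G * R t ^ 2
    rw [hμ, hG]
    exact le_of_eq (by ring)
  have hR0 : Real.sqrt (∑' k : d → ℤ, freqNormSq k ^ s *
      ‖mFourierCoeff (EuclideanSpace.complexify ∘ (fun y => u₀ y -
        (0 : ℝ → UnitAddTorus d → EuclideanSpace ℝ d) 0 y)) k‖ ^ 2) ≤ R 0 := by
    have hfun : (fun y => u₀ y - (0 : ℝ → UnitAddTorus d → EuclideanSpace ℝ d) 0 y) = u₀ := by
      funext y; simp
    rw [hfun]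
    show R₀ ≤ R₀ * Real.exp (-μ * 0) / (1 - G * R₀ * (1 - Real.exp (-μ * 0)) / μ)
    simp
  obtain ⟨u, p, hu, hu0, hmu, hb⟩ := Torus.classicalNS_regular_of_sobolev_control_kernels hd hν hT
    hs1 hGker (fun k H => NSSobolev.sum_wedgeKernel_le_mpp (d := d) hs1 hsdK k H) hv hmv
    (D₀ := fun _ => 0) (D₁ := fun _ => 0) (E := fun _ => 0) continuousOn_const continuousOn_const
    (hD s) (hD (s + 1)) (hD s) hu₀ hdiv hmean hRc hRd hRge hR0
  refine ⟨u, p, hu, hu0, hmu, fun t ht => ?_⟩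
  have h := hb t ht
  have hfun : (fun y => u t y - (0 : ℝ → UnitAddTorus d → EuclideanSpace ℝ d) t y) = u t := by
    funext y; simp
  rw [hfun] at h
  exact h


/-- **The `ν`-independent lifespan bound of Prop. 5.1**: `T_c ≥ 1/(G_n‖u₀‖_n)` (MP: "intending
`1/(G_n‖u₀‖_n)` if `ν = 0`"; `1 − e^{−μT} ≤ μT`): if `2π√Gsq · ‖u₀‖_s · T < 1` then the classical
solution from `u₀` exists on `[0, T]`, with the bound of
`Torus.classicalNS_regular_of_hsNorm_kernels`. [cite: MorosiPizzocchero2015, Prop. 5.1 (5.2)] -/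
theorem Torus.classicalNS_regular_of_hsNorm_mul_lt_one_kernels (hd : Fintype.card d = 3) {ν : ℝ}
    (hν : 0 < ν) {T : ℝ} (hT : 0 < T) {s : ℝ} (hs : 3 / 2 < s)
    {Gsq : ℝ} (hGker : ∀ (k : d → ℤ) (H : Finset (d → ℤ)), ∑ h ∈ H,
      (freqNormSq h * freqNormSq k - (∑ j, (h j : ℝ) * (k j : ℝ)) ^ 2) *
        (freqNormSq k ^ (s / 2) - freqNormSq (k - h) ^ (s / 2)) ^ 2 /
        (freqNormSq h ^ (s + 1) * freqNormSq (k - h) ^ s) ≤ Gsq)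
    {u₀ : UnitAddTorus d → EuclideanSpace ℝ d} (hu₀ : Torus.IsSmooth u₀)
    (hdiv : Torus.IsDivFree u₀) (hmean : Torus.HasZeroMean u₀)
    (hT1 : 2 * Real.pi * Real.sqrt Gsq * Real.sqrt (∑' k : d → ℤ, freqNormSq k ^ s *
      ‖mFourierCoeff (EuclideanSpace.complexify ∘ u₀) k‖ ^ 2) * T < 1) :
    ∃ (u : ℝ → UnitAddTorus d → EuclideanSpace ℝ d) (p : ℝ → UnitAddTorus d → ℝ),
      Torus.IsClassicalNSSolutionOn (Icc 0 T) ν 0 u p ∧ u 0 = u₀ ∧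
      (∀ t ∈ Icc 0 T, Torus.HasZeroMean (u t)) ∧
      ∀ t ∈ Icc 0 T, Real.sqrt (∑' k : d → ℤ, freqNormSq k ^ s *
        ‖mFourierCoeff (EuclideanSpace.complexify ∘ u t) k‖ ^ 2) ≤
        Real.sqrt (∑' k : d → ℤ, freqNormSq k ^ s *
          ‖mFourierCoeff (EuclideanSpace.complexify ∘ u₀) k‖ ^ 2) *
          Real.exp (-(4 * Real.pi ^ 2 * ν) * t) /
          (1 - 2 * Real.pi * Real.sqrt Gsq * Real.sqrt (∑' k : d → ℤ, freqNormSq k ^ s *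
            ‖mFourierCoeff (EuclideanSpace.complexify ∘ u₀) k‖ ^ 2) *
            (1 - Real.exp (-(4 * Real.pi ^ 2 * ν) * t)) / (4 * Real.pi ^ 2 * ν)) := by
  refine Torus.classicalNS_regular_of_hsNorm_kernels hd hν hT hs hGker hu₀ hdiv hmean ?_
  set μ : ℝ := 4 * Real.pi ^ 2 * ν with hμ
  have hμ0 : 0 < μ := by rw [hμ]; positivity
  set A : ℝ := 2 * Real.pi * Real.sqrt Gsq * Real.sqrt (∑' k : d → ℤ, freqNormSq k ^ s *
    ‖mFourierCoeff (EuclideanSpace.complexify ∘ u₀) k‖ ^ 2) with hA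
  have hA0 : 0 ≤ A := by rw [hA]; positivity
  -- `1 − e^{−μT} ≤ μT`
  have hexp : 1 - Real.exp (-μ * T) ≤ μ * T := by
    have h := Real.add_one_le_exp (-μ * T)
    linarith
  calc A * (1 - Real.exp (-μ * T)) ≤ A * (μ * T) := mul_le_mul_of_nonneg_left hexp hA0
    _ = μ * (A * T) := by ring
    _ < μ * 1 := mul_lt_mul_of_pos_left hT1 hμ0
    _ = μ := mul_one μ

/-- **Small `Ḣ^s` data are global (MP 2015 Prop. 5.1, the case `‖u₀‖_n ≤ ν/G_n`)**: if
`2π√Gsq · ‖u₀‖_s ≤ 4π²ν` then the classical solution from the smooth divergence-free mean-zero datum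
`u₀` on `T³` is GLOBAL, with `‖u(t)‖_s ≤ ‖u₀‖_s e^{−μt}/(1 − G‖u₀‖_s(1 − e^{−μt})/μ)` for all
`t ≥ 0` (`μ = 4π²ν`, `G = 2π√Gsq`) — "u is global (`T = +∞`) and its norm of any Sobolev order
decays exponentially for `t → +∞`" (here: the order `s` of the hypothesis). Proof as printed, via
`Torus.classicalNS_global_of_sobolev_control_kernels` with `u_a = 0`.
[cite: MorosiPizzocchero2015, Prop. 5.1; MorosiPizzocchero2012Approx, Prop. 5.2] -/
theorem Torus.classicalNS_global_of_hsNorm_kernels (hd : Fintype.card d = 3) {ν : ℝ}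
    (hν : 0 < ν) {s : ℝ} (hs : 3 / 2 < s)
    {Gsq : ℝ} (hGker : ∀ (k : d → ℤ) (H : Finset (d → ℤ)), ∑ h ∈ H,
      (freqNormSq h * freqNormSq k - (∑ j, (h j : ℝ) * (k j : ℝ)) ^ 2) *
        (freqNormSq k ^ (s / 2) - freqNormSq (k - h) ^ (s / 2)) ^ 2 /
        (freqNormSq h ^ (s + 1) * freqNormSq (k - h) ^ s) ≤ Gsq)
    {u₀ : UnitAddTorus d → EuclideanSpace ℝ d} (hu₀ : Torus.IsSmooth u₀)
    (hdiv : Torus.IsDivFree u₀) (hmean : Torus.HasZeroMean u₀)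
    (hsmall : 2 * Real.pi * Real.sqrt Gsq * Real.sqrt (∑' k : d → ℤ, freqNormSq k ^ s *
      ‖mFourierCoeff (EuclideanSpace.complexify ∘ u₀) k‖ ^ 2) ≤ 4 * Real.pi ^ 2 * ν) :
    ∃ (u : ℝ → UnitAddTorus d → EuclideanSpace ℝ d) (p : ℝ → UnitAddTorus d → ℝ),
      Torus.IsClassicalNSSolutionOn (Ici 0) ν 0 u p ∧ u 0 = u₀ ∧
      (∀ t ∈ Ici (0 : ℝ), Torus.HasZeroMean (u t)) ∧
      ∀ t ∈ Ici (0 : ℝ), Real.sqrt (∑' k : d → ℤ, freqNormSq k ^ s *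
        ‖mFourierCoeff (EuclideanSpace.complexify ∘ u t) k‖ ^ 2) ≤
        Real.sqrt (∑' k : d → ℤ, freqNormSq k ^ s *
          ‖mFourierCoeff (EuclideanSpace.complexify ∘ u₀) k‖ ^ 2) *
          Real.exp (-(4 * Real.pi ^ 2 * ν) * t) /
          (1 - 2 * Real.pi * Real.sqrt Gsq * Real.sqrt (∑' k : d → ℤ, freqNormSq k ^ s *
            ‖mFourierCoeff (EuclideanSpace.complexify ∘ u₀) k‖ ^ 2) *
            (1 - Real.exp (-(4 * Real.pi ^ 2 * ν) * t)) / (4 * Real.pi ^ 2 * ν)) := by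
  classical
  have hn : (Fintype.card d : ℝ) = 3 := by rw [hd]; norm_num
  have hs1 : (1 : ℝ) ≤ s := by linarith
  have hsdK : (Fintype.card d : ℝ) < 2 * s := by rw [hn]; linarith
  set μ : ℝ := 4 * Real.pi ^ 2 * ν with hμ
  have hμ0 : 0 < μ := by rw [hμ]; positivity
  set G : ℝ := 2 * Real.pi * Real.sqrt Gsq with hG
  have hG0 : 0 ≤ G := by rw [hG]; positivity
  set R₀ : ℝ := Real.sqrt (∑' k : d → ℤ, freqNormSq k ^ s *
    ‖mFourierCoeff (EuclideanSpace.complexify ∘ u₀) k‖ ^ 2) with hR₀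
  have hR₀0 : 0 ≤ R₀ := Real.sqrt_nonneg _
  have hc : G * R₀ ≤ μ := hsmall
  -- the denominator is positive on `[0, ∞)`: `φ(t) ≥ e^{−μt}`
  set φ : ℝ → ℝ := fun t => 1 - G * R₀ * (1 - Real.exp (-μ * t)) / μ with hφ
  have hφpos : ∀ t ∈ Ici (0 : ℝ), 0 < φ t := by
    intro t ht
    have hexp1 : Real.exp (-μ * t) ≤ 1 := by
      rw [Real.exp_le_one_iff]; nlinarith [mem_Ici.1 ht, hμ0]
    have h1 : G * R₀ * (1 - Real.exp (-μ * t)) ≤ μ * (1 - Real.exp (-μ * t)) :=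
      mul_le_mul_of_nonneg_right hc (by linarith)
    have h2 : G * R₀ * (1 - Real.exp (-μ * t)) / μ ≤ 1 - Real.exp (-μ * t) := by
      rw [div_le_iff₀ hμ0]; linarith
    show 0 < 1 - G * R₀ * (1 - Real.exp (-μ * t)) / μ
    linarith [Real.exp_pos (-μ * t)]
  set R : ℝ → ℝ := fun t => R₀ * Real.exp (-μ * t) / φ t with hR
  set R' : ℝ → ℝ := fun t => -μ * R t + G * R t ^ 2 with hR'
  have hv : Torus.IsClassicalNSSolutionOn (Ici 0) ν
      (0 : ℝ → UnitAddTorus d → EuclideanSpace ℝ d) 0 0 := za_restState _ _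
  have hmv : ∀ t ∈ Ici (0 : ℝ),
      Torus.HasZeroMean ((0 : ℝ → UnitAddTorus d → EuclideanSpace ℝ d) t) := by
    intro t _
    simp [Torus.HasZeroMean]
  have hD : ∀ (r : ℝ), ∀ t ∈ Ici (0 : ℝ), Real.sqrt (∑' k : d → ℤ, freqNormSq k ^ r *
      ‖mFourierCoeff (EuclideanSpace.complexify ∘
        (0 : ℝ → UnitAddTorus d → EuclideanSpace ℝ d) t) k‖ ^ 2) ≤ (fun _ : ℝ => (0 : ℝ)) t :=
    fun r t _ => (za_sqrt_tsum_zero r t).le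
  have hRc : ContinuousOn R (Ici 0) := by
    have hEc : Continuous fun t : ℝ => Real.exp (-μ * t) :=
      Real.continuous_exp.comp (continuous_const.mul continuous_id)
    have hNc : Continuous fun t : ℝ => R₀ * Real.exp (-μ * t) := continuous_const.mul hEc
    have hφc : Continuous φ :=
      continuous_const.sub ((continuous_const.mul (continuous_const.sub hEc)).div_const _)
    exact hNc.continuousOn.div hφc.continuousOn fun t ht => (hφpos t ht).ne'
  have hRd : ∀ t ∈ Ici (0 : ℝ), HasDerivWithinAt R (R' t) (Ici t) t := by
    intro t ht
    exact (za_riccati_hasDerivAt (G := G) (R₀ := R₀) hμ0.ne' (hφpos t ht).ne').hasDerivWithinAt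
  have hRge : ∀ t ∈ Ici (0 : ℝ),
      -(4 * Real.pi ^ 2 * ν) * R t +
        (2 * Real.pi * Real.sqrt Gsq * (fun _ : ℝ => (0 : ℝ)) t +
          2 * Real.pi * Real.sqrt (((2 : ℝ) ^ (2 * s + 2) * (s + 1) ^ (s + 1) / (s + 2) ^ (s + 2)) *
            ∑' m : d → ℤ, (if m = 0 then (0 : ℝ) else freqNormSq m ^ (-s))) *
            (fun _ : ℝ => (0 : ℝ)) t) * R t +
        2 * Real.pi * Real.sqrt Gsq * R t ^ 2 + (fun _ : ℝ => (0 : ℝ)) t ≤ R' t := by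
    intro t _
    show -(4 * Real.pi ^ 2 * ν) * R t + (2 * Real.pi * Real.sqrt Gsq * 0 +
      2 * Real.pi * Real.sqrt (((2 : ℝ) ^ (2 * s + 2) * (s + 1) ^ (s + 1) / (s + 2) ^ (s + 2)) *
        ∑' m : d → ℤ, (if m = 0 then (0 : ℝ) else freqNormSq m ^ (-s))) * 0) * R t +
      2 * Real.pi * Real.sqrt Gsq * R t ^ 2 + 0 ≤ -μ * R t + G * R t ^ 2
    rw [hμ, hG]
    exact le_of_eq (by ring)
  have hR0 : Real.sqrt (∑' k : d → ℤ, freqNormSq k ^ s *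
      ‖mFourierCoeff (EuclideanSpace.complexify ∘ (fun y => u₀ y -
        (0 : ℝ → UnitAddTorus d → EuclideanSpace ℝ d) 0 y)) k‖ ^ 2) ≤ R 0 := by
    have hfun : (fun y => u₀ y - (0 : ℝ → UnitAddTorus d → EuclideanSpace ℝ d) 0 y) = u₀ := by
      funext y; simp
    rw [hfun]
    show R₀ ≤ R₀ * Real.exp (-μ * 0) / (1 - G * R₀ * (1 - Real.exp (-μ * 0)) / μ)
    simp
  obtain ⟨u, p, hu, hu0, hmu, hb⟩ := Torus.classicalNS_global_of_sobolev_control_kernels hd hν hs1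
    hGker (fun k H => NSSobolev.sum_wedgeKernel_le_mpp (d := d) hs1 hsdK k H) hv hmv
    (D₀ := fun _ => 0) (D₁ := fun _ => 0) (E := fun _ => 0) continuousOn_const continuousOn_const
    (hD s) (hD (s + 1)) (hD s) hu₀ hdiv hmean hRc hRd hRge hR0
  refine ⟨u, p, hu, hu0, hmu, fun t ht => ?_⟩
  have h := hb t ht
  have hfun : (fun y => u t y - (0 : ℝ → UnitAddTorus d → EuclideanSpace ℝ d) t y) = u t := by
    funext y; simp
  rw [hfun] at h
  exact h

/-! ### §3 `n = 3`: the hypothesis-free Kato constant `G = 2π(24ζ₄)^{1/2}` -/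

/-- **Prop. 5.1 on `T³` at `n = 3`, `ν`-independent lifespan**: with `ζ₄ = ∑_{k≠0}|k|^{−4}` and the
tree's Kato constant `G = 2π(24ζ₄)^{1/2} ≈ 125` (`NSSobolev.sum_gramKernel_le_three`), if
`G ‖u₀‖₃ T < 1` then the classical solution from `u₀` exists on `[0, T]` and obeys MP's bound
`‖u(t)‖₃ ≤ ‖u₀‖₃e^{−μt}/(1 − G‖u₀‖₃(1 − e^{−μt})/μ)`, `μ = 4π²ν` — NO lattice-supremum hypothesis
(MP's certified `G₃ = 0.438` on `(ℝ/2πℤ)³` reads `≈ 43` here).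
[cite: MorosiPizzocchero2015, Prop. 5.1; MorosiPizzocchero2012Kato, Prop. 3.5, Lemma 5.3] -/
theorem Torus.classicalNS_regular_of_hsNorm_three (hd : Fintype.card d = 3) {ν : ℝ}
    (hν : 0 < ν) {T : ℝ} (hT : 0 < T) {s : ℝ} (hs3 : s = 3)
    {u₀ : UnitAddTorus d → EuclideanSpace ℝ d} (hu₀ : Torus.IsSmooth u₀)
    (hdiv : Torus.IsDivFree u₀) (hmean : Torus.HasZeroMean u₀)
    (hT1 : 2 * Real.pi * Real.sqrt (24 *
        ∑' k : d → ℤ, (if k = 0 then (0 : ℝ) else freqNormSq k ^ (-(s - 1)))) *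
      Real.sqrt (∑' k : d → ℤ, freqNormSq k ^ s *
        ‖mFourierCoeff (EuclideanSpace.complexify ∘ u₀) k‖ ^ 2) * T < 1) :
    ∃ (u : ℝ → UnitAddTorus d → EuclideanSpace ℝ d) (p : ℝ → UnitAddTorus d → ℝ),
      Torus.IsClassicalNSSolutionOn (Icc 0 T) ν 0 u p ∧ u 0 = u₀ ∧
      (∀ t ∈ Icc 0 T, Torus.HasZeroMean (u t)) ∧
      ∀ t ∈ Icc 0 T, Real.sqrt (∑' k : d → ℤ, freqNormSq k ^ s *
        ‖mFourierCoeff (EuclideanSpace.complexify ∘ u t) k‖ ^ 2) ≤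
        Real.sqrt (∑' k : d → ℤ, freqNormSq k ^ s *
          ‖mFourierCoeff (EuclideanSpace.complexify ∘ u₀) k‖ ^ 2) *
          Real.exp (-(4 * Real.pi ^ 2 * ν) * t) /
          (1 - 2 * Real.pi * Real.sqrt (24 *
              ∑' k : d → ℤ, (if k = 0 then (0 : ℝ) else freqNormSq k ^ (-(s - 1)))) *
            Real.sqrt (∑' k : d → ℤ, freqNormSq k ^ s *
              ‖mFourierCoeff (EuclideanSpace.complexify ∘ u₀) k‖ ^ 2) *
            (1 - Real.exp (-(4 * Real.pi ^ 2 * ν) * t)) / (4 * Real.pi ^ 2 * ν)) := by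
  classical
  have hn : (Fintype.card d : ℝ) = 3 := by rw [hd]; norm_num
  have hs : (3 : ℝ) / 2 < s := by rw [hs3]; norm_num
  have hsdG : (Fintype.card d : ℝ) < 2 * (s - 1) := by rw [hn, hs3]; norm_num
  exact Torus.classicalNS_regular_of_hsNorm_mul_lt_one_kernels hd hν hT hs
    (fun k H => NSSobolev.sum_gramKernel_le_three (d := d) hs3 hsdG k H) hu₀ hdiv hmean hT1

/-- **Prop. 5.1 on `T³` at `n = 3`, small data**: if `2π(24ζ₄)^{1/2}‖u₀‖₃ ≤ 4π²ν`
(`2π(24ζ₄)^{1/2} ≈ 125`, i.e. `‖u₀‖₃ ≤ 0.315ν` on the unit torus with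
`‖w‖₃² = ∑|k|⁶‖ŵ(k)‖²`) then the classical solution from `u₀` is GLOBAL and
`‖u(t)‖₃ ≤ ‖u₀‖₃e^{−4π²νt}/(1 − G‖u₀‖₃(1 − e^{−4π²νt})/(4π²ν))` for all `t ≥ 0` — no lattice-supremum
hypothesis. [cite: MorosiPizzocchero2015, Prop. 5.1; MorosiPizzocchero2012Kato, Prop. 3.5, Lemma 5.3] -/
theorem Torus.classicalNS_global_of_hsNorm_three (hd : Fintype.card d = 3) {ν : ℝ}
    (hν : 0 < ν) {s : ℝ} (hs3 : s = 3)
    {u₀ : UnitAddTorus d → EuclideanSpace ℝ d} (hu₀ : Torus.IsSmooth u₀)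
    (hdiv : Torus.IsDivFree u₀) (hmean : Torus.HasZeroMean u₀)
    (hsmall : 2 * Real.pi * Real.sqrt (24 *
        ∑' k : d → ℤ, (if k = 0 then (0 : ℝ) else freqNormSq k ^ (-(s - 1)))) *
      Real.sqrt (∑' k : d → ℤ, freqNormSq k ^ s *
        ‖mFourierCoeff (EuclideanSpace.complexify ∘ u₀) k‖ ^ 2) ≤ 4 * Real.pi ^ 2 * ν) :
    ∃ (u : ℝ → UnitAddTorus d → EuclideanSpace ℝ d) (p : ℝ → UnitAddTorus d → ℝ),
      Torus.IsClassicalNSSolutionOn (Ici 0) ν 0 u p ∧ u 0 = u₀ ∧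
      (∀ t ∈ Ici (0 : ℝ), Torus.HasZeroMean (u t)) ∧
      ∀ t ∈ Ici (0 : ℝ), Real.sqrt (∑' k : d → ℤ, freqNormSq k ^ s *
        ‖mFourierCoeff (EuclideanSpace.complexify ∘ u t) k‖ ^ 2) ≤
        Real.sqrt (∑' k : d → ℤ, freqNormSq k ^ s *
          ‖mFourierCoeff (EuclideanSpace.complexify ∘ u₀) k‖ ^ 2) *
          Real.exp (-(4 * Real.pi ^ 2 * ν) * t) /
          (1 - 2 * Real.pi * Real.sqrt (24 *
              ∑' k : d → ℤ, (if k = 0 then (0 : ℝ) else freqNormSq k ^ (-(s - 1)))) *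
            Real.sqrt (∑' k : d → ℤ, freqNormSq k ^ s *
              ‖mFourierCoeff (EuclideanSpace.complexify ∘ u₀) k‖ ^ 2) *
            (1 - Real.exp (-(4 * Real.pi ^ 2 * ν) * t)) / (4 * Real.pi ^ 2 * ν)) := by
  classical
  have hn : (Fintype.card d : ℝ) = 3 := by rw [hd]; norm_num
  have hs : (3 : ℝ) / 2 < s := by rw [hs3]; norm_num
  have hsdG : (Fintype.card d : ℝ) < 2 * (s - 1) := by rw [hn, hs3]; norm_num
  exact Torus.classicalNS_global_of_hsNorm_kernels hd hν hs
    (fun k H => NSSobolev.sum_gramKernel_le_three (d := d) hs3 hsdG k H) hu₀ hdiv hmean hsmall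

/-! ### §4 Global stability of global decaying solutions (Pizzocchero 2021, Thm. 5.1) -/

/-- **Global stability of a global, decaying solution — Pizzocchero's Thm. 5.1, kernel form.**
Let `v` be a GLOBAL classical mean-zero solution of the unforced equations on the unit torus
(`card d = 3`, `ν > 0`, `s ≥ 1`) with continuous envelopes `‖v(t)‖_s ≤ D₀(t)`,
`‖v(t)‖_{s+1} ≤ D₁(t)` and an antiderivative `Λ` of `γ := 2π√Gsq·D₀ + 2π√Ksq·D₁` (`Λ(0) = 0`,
one-sided derivatives within `[0, ∞)`) bounded above: `Λ ≤ L` on `[0, ∞)` (Pizzocchero: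
`G_nJ_n + K_nJ_{n+1}`, `J_p = ∫₀^∞‖v‖_p`). Put `μ = 4π²ν`, `G = 2π√Gsq`, `δ = ‖u₀ − v(0)‖_s` and
`ρ := (μ/G)e^{−L}` ("`ρ_n := (ν/G_n)e^{−G_nJ_n − K_nJ_{n+1}}`", (5.2)). If `δ < ρ` — here
`G δ e^{L} < μ` — then the classical solution `u` from the smooth divergence-free mean-zero datum
`u₀` is GLOBAL and, for all `t ≥ 0`,
`‖u(t) − v(t)‖_s ≤ δ e^{Λ(t) − μt}/(1 − G δ e^{L}(1 − e^{−μt})/μ) (≤ e^{L}δe^{−μt}/(1 − δ/ρ)`, the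
printed (5.4): `Torus.classicalNS_global_stability_kernels'`). Proof as printed (ibid. (5.6)–(5.17)):
`Torus.classicalNS_global_of_sobolev_control_kernels` with `u_a := v` (errors `ε = 0`,
`𝒟_p = ‖v‖_p`, `δ_n`), the control inequality `Ṙ = −μR + γR + G R²` being solved by the Bernoulli
substitution; we use the explicit supersolution `R = δe^{Λ−μt}/(1 − Gδe^{L}(1 − e^{−μt})/μ)` obtained
from the exact solution (5.10)–(5.11) by the bound `L_n(t) ≤ e^{L}(1 − e^{−μt})/μ` of (5.12).
Pizzocchero: `(ℝ/2πℤ)^d`, any `n > d/2 + 1`, `v₀ ∈ E^∞` (global decaying, all `J_p < ∞`), with the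
`p > n` bounds and the decay of `u`; here the `n`-level statement on `T³` in our normalisation
(`−νR ↦ −4π²νR`, `G_n ↦ 2π√Gsq`, `K_n ↦ 2π√Ksq`), `L` any upper bound of `Λ`.
[cite: Pizzocchero2021, Thm. 5.1 (5.2)–(5.4) with proof (5.6)–(5.17); MorosiPizzocchero2015, Prop. 4.4 (i)] -/
theorem Torus.classicalNS_global_stability_kernels (hd : Fintype.card d = 3) {ν : ℝ}
    (hν : 0 < ν) {s : ℝ} (hs : 1 ≤ s)
    {Gsq : ℝ} (hGker : ∀ (k : d → ℤ) (H : Finset (d → ℤ)), ∑ h ∈ H,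
      (freqNormSq h * freqNormSq k - (∑ j, (h j : ℝ) * (k j : ℝ)) ^ 2) *
        (freqNormSq k ^ (s / 2) - freqNormSq (k - h) ^ (s / 2)) ^ 2 /
        (freqNormSq h ^ (s + 1) * freqNormSq (k - h) ^ s) ≤ Gsq)
    {Ksq : ℝ} (hKker : ∀ (k : d → ℤ) (H : Finset (d → ℤ)), ∑ h ∈ H,
      freqNormSq k ^ s * (freqNormSq h * freqNormSq k - (∑ j, (h j : ℝ) * (k j : ℝ)) ^ 2) /
        (freqNormSq h ^ (s + 1) * freqNormSq (k - h) ^ (s + 1)) ≤ Ksq)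
    {v : ℝ → UnitAddTorus d → EuclideanSpace ℝ d} {q : ℝ → UnitAddTorus d → ℝ}
    (hv : Torus.IsClassicalNSSolutionOn (Ici 0) ν 0 v q)
    (hmv : ∀ t ∈ Ici (0 : ℝ), Torus.HasZeroMean (v t))
    {D₀ D₁ : ℝ → ℝ} (hD₀c : ContinuousOn D₀ (Ici 0)) (hD₁c : ContinuousOn D₁ (Ici 0))
    (hD₀ : ∀ t ∈ Ici (0 : ℝ), Real.sqrt (∑' k : d → ℤ, freqNormSq k ^ s *
      ‖mFourierCoeff (EuclideanSpace.complexify ∘ v t) k‖ ^ 2) ≤ D₀ t)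
    (hD₁ : ∀ t ∈ Ici (0 : ℝ), Real.sqrt (∑' k : d → ℤ, freqNormSq k ^ (s + 1) *
      ‖mFourierCoeff (EuclideanSpace.complexify ∘ v t) k‖ ^ 2) ≤ D₁ t)
    {Λ : ℝ → ℝ} {L : ℝ}
    (hΛ : ∀ t ∈ Ici (0 : ℝ), HasDerivWithinAt Λ
      (2 * Real.pi * Real.sqrt Gsq * D₀ t + 2 * Real.pi * Real.sqrt Ksq * D₁ t) (Ici 0) t)
    (hΛ0 : Λ 0 = 0) (hΛL : ∀ t ∈ Ici (0 : ℝ), Λ t ≤ L)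
    {u₀ : UnitAddTorus d → EuclideanSpace ℝ d} (hu₀ : Torus.IsSmooth u₀)
    (hdiv : Torus.IsDivFree u₀) (hmean : Torus.HasZeroMean u₀)
    (hclose : 2 * Real.pi * Real.sqrt Gsq * Real.sqrt (∑' k : d → ℤ, freqNormSq k ^ s *
      ‖mFourierCoeff (EuclideanSpace.complexify ∘ (fun y => u₀ y - v 0 y)) k‖ ^ 2) *
        Real.exp L < 4 * Real.pi ^ 2 * ν) :
    ∃ (u : ℝ → UnitAddTorus d → EuclideanSpace ℝ d) (p : ℝ → UnitAddTorus d → ℝ),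
      Torus.IsClassicalNSSolutionOn (Ici 0) ν 0 u p ∧ u 0 = u₀ ∧
      (∀ t ∈ Ici (0 : ℝ), Torus.HasZeroMean (u t)) ∧
      ∀ t ∈ Ici (0 : ℝ), Real.sqrt (∑' k : d → ℤ, freqNormSq k ^ s *
        ‖mFourierCoeff (EuclideanSpace.complexify ∘ (fun y => u t y - v t y)) k‖ ^ 2) ≤
        Real.sqrt (∑' k : d → ℤ, freqNormSq k ^ s *
          ‖mFourierCoeff (EuclideanSpace.complexify ∘ (fun y => u₀ y - v 0 y)) k‖ ^ 2) *
          Real.exp (Λ t - 4 * Real.pi ^ 2 * ν * t) /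
          (1 - 2 * Real.pi * Real.sqrt Gsq * Real.sqrt (∑' k : d → ℤ, freqNormSq k ^ s *
            ‖mFourierCoeff (EuclideanSpace.complexify ∘ (fun y => u₀ y - v 0 y)) k‖ ^ 2) *
            Real.exp L * (1 - Real.exp (-(4 * Real.pi ^ 2 * ν) * t)) / (4 * Real.pi ^ 2 * ν)) := by
  classical
  set μ : ℝ := 4 * Real.pi ^ 2 * ν with hμ
  have hμ0 : 0 < μ := by rw [hμ]; positivity
  set G : ℝ := 2 * Real.pi * Real.sqrt Gsq with hG
  have hG0 : 0 ≤ G := by rw [hG]; positivity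
  set K : ℝ := 2 * Real.pi * Real.sqrt Ksq with hK
  set δ : ℝ := Real.sqrt (∑' k : d → ℤ, freqNormSq k ^ s *
    ‖mFourierCoeff (EuclideanSpace.complexify ∘ (fun y => u₀ y - v 0 y)) k‖ ^ 2) with hδ
  have hδ0 : 0 ≤ δ := Real.sqrt_nonneg _
  -- `c = G δ e^L / μ < 1`
  set c : ℝ := G * δ * Real.exp L / μ with hc
  have hc0 : 0 ≤ c := by rw [hc]; positivity
  have hc1 : c < 1 := by rw [hc, div_lt_one hμ0]; exact hclose
  have hcμ : c * μ = G * δ * Real.exp L := by rw [hc]; field_simp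
  -- the denominator `φ(t) = 1 − c(1 − e^{−μt}) > 0` on `[0, ∞)`
  set φ : ℝ → ℝ := fun t => 1 - c * (1 - Real.exp (-μ * t)) with hφ
  have hφpos : ∀ t ∈ Ici (0 : ℝ), 0 < φ t := by
    intro t ht
    have hexp1 : Real.exp (-μ * t) ≤ 1 := by
      rw [Real.exp_le_one_iff]; nlinarith [mem_Ici.1 ht, hμ0]
    have h1 : c * (1 - Real.exp (-μ * t)) ≤ 1 * (1 - Real.exp (-μ * t)) :=
      mul_le_mul_of_nonneg_right hc1.le (by linarith)
    show 0 < 1 - c * (1 - Real.exp (-μ * t))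
    nlinarith [Real.exp_pos (-μ * t)]
  set γ : ℝ → ℝ := fun t => G * D₀ t + K * D₁ t with hγ
  set R : ℝ → ℝ := fun t => δ * Real.exp (Λ t - μ * t) / φ t with hR
  set R' : ℝ → ℝ := fun t =>
    (δ * (Real.exp (Λ t - μ * t) * (γ t - μ)) * φ t -
      δ * Real.exp (Λ t - μ * t) * (-(c * μ * Real.exp (-μ * t)))) / φ t ^ 2 with hR'
  have hΛc : ContinuousOn Λ (Ici 0) := fun t ht => (hΛ t ht).continuousWithinAt
  have hRc : ContinuousOn R (Ici 0) := by
    have hEc : Continuous fun t : ℝ => Real.exp (-μ * t) :=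
      Real.continuous_exp.comp (continuous_const.mul continuous_id)
    have hNc : ContinuousOn (fun t : ℝ => δ * Real.exp (Λ t - μ * t)) (Ici 0) :=
      continuousOn_const.mul ((hΛc.sub (continuousOn_const.mul continuousOn_id)).rexp)
    have hφc : Continuous φ := continuous_const.sub (continuous_const.mul (continuous_const.sub hEc))
    exact hNc.div hφc.continuousOn fun t ht => (hφpos t ht).ne'
  have hRd : ∀ t ∈ Ici (0 : ℝ), HasDerivWithinAt R (R' t) (Ici t) t := by
    intro t ht
    have hlin : HasDerivWithinAt (fun τ : ℝ => μ * τ) μ (Ici 0) t := by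
      simpa using ((hasDerivWithinAt_id t (Ici (0 : ℝ))).const_mul μ)
    have hE : HasDerivWithinAt (fun τ => Real.exp (Λ τ - μ * τ))
        (Real.exp (Λ t - μ * t) * (γ t - μ)) (Ici 0) t := ((hΛ t ht).sub hlin).exp
    have hN : HasDerivWithinAt (fun τ => δ * Real.exp (Λ τ - μ * τ))
        (δ * (Real.exp (Λ t - μ * t) * (γ t - μ))) (Ici 0) t := hE.const_mul δ
    have hlin' : HasDerivAt (fun τ : ℝ => -μ * τ) (-μ) t := by
      simpa using (hasDerivAt_id t).const_mul (-μ)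
    have hφd : HasDerivAt φ (-(c * (-(Real.exp (-μ * t) * (-μ))))) t :=
      ((hlin'.exp).const_sub 1).const_mul c |>.const_sub 1
    have hφd' : HasDerivWithinAt φ (-(c * μ * Real.exp (-μ * t))) (Ici 0) t := by
      have h := hφd.hasDerivWithinAt (s := Ici (0 : ℝ))
      refine h.congr_deriv ?_
      ring
    exact ((hN.div hφd' (hφpos t ht).ne')).mono (Ici_subset_Ici.2 (mem_Ici.1 ht))
  have hRge : ∀ t ∈ Ici (0 : ℝ),
      -(4 * Real.pi ^ 2 * ν) * R t +
        (2 * Real.pi * Real.sqrt Gsq * D₀ t + 2 * Real.pi * Real.sqrt Ksq * D₁ t) * R t +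
        2 * Real.pi * Real.sqrt Gsq * R t ^ 2 + (fun _ : ℝ => (0 : ℝ)) t ≤ R' t := by
    intro t ht
    have hφt : 0 < φ t := hφpos t ht
    set a : ℝ := Real.exp (Λ t - μ * t) with ha
    set e : ℝ := Real.exp (-μ * t) with he
    have ha0 : 0 < a := Real.exp_pos _
    have he0 : 0 < e := Real.exp_pos _
    -- `a = e^{Λ t} e ≤ e^{L} e`
    have haLe : G * δ * a ≤ c * μ * e := by
      rw [hcμ, ha, he]
      have h1 : Real.exp (Λ t - μ * t) = Real.exp (Λ t) * Real.exp (-μ * t) := by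
        rw [← Real.exp_add]; ring_nf
      rw [h1]
      have h2 : Real.exp (Λ t) ≤ Real.exp L := Real.exp_le_exp.2 (hΛL t ht)
      have h3 : 0 ≤ G * δ := mul_nonneg hG0 hδ0
      calc G * δ * (Real.exp (Λ t) * Real.exp (-μ * t))
          = G * δ * Real.exp (Λ t) * Real.exp (-μ * t) := by ring
        _ ≤ G * δ * Real.exp L * Real.exp (-μ * t) :=
          mul_le_mul_of_nonneg_right (mul_le_mul_of_nonneg_left h2 h3) (Real.exp_pos _).le
    show -(4 * Real.pi ^ 2 * ν) * (δ * a / φ t) +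
        (2 * Real.pi * Real.sqrt Gsq * D₀ t + 2 * Real.pi * Real.sqrt Ksq * D₁ t) * (δ * a / φ t) +
        2 * Real.pi * Real.sqrt Gsq * (δ * a / φ t) ^ 2 + 0 ≤
      (δ * (a * (γ t - μ)) * φ t - δ * a * (-(c * μ * e))) / φ t ^ 2
    rw [← hμ, ← hG, ← hK]
    have hγt : γ t = G * D₀ t + K * D₁ t := rfl
    rw [hγt]
    have hkey : (δ * (a * (G * D₀ t + K * D₁ t - μ)) * φ t - δ * a * (-(c * μ * e))) / φ t ^ 2 -
        (-μ * (δ * a / φ t) + (G * D₀ t + K * D₁ t) * (δ * a / φ t) +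
          G * (δ * a / φ t) ^ 2 + 0) = δ * a * (c * μ * e - G * δ * a) / φ t ^ 2 := by
      field_simp
      ring
    have hnn : 0 ≤ δ * a * (c * μ * e - G * δ * a) / φ t ^ 2 :=
      div_nonneg (mul_nonneg (mul_nonneg hδ0 ha0.le) (by linarith)) (sq_nonneg _)
    linarith [hkey, hnn]
  have hR0 : Real.sqrt (∑' k : d → ℤ, freqNormSq k ^ s *
      ‖mFourierCoeff (EuclideanSpace.complexify ∘ (fun y => u₀ y - v 0 y)) k‖ ^ 2) ≤ R 0 := by
    show δ ≤ δ * Real.exp (Λ 0 - μ * 0) / (1 - c * (1 - Real.exp (-μ * 0)))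
    rw [hΛ0]; simp
  obtain ⟨u, p, hu, hu0, hmu, hb⟩ := Torus.classicalNS_global_of_sobolev_control_kernels hd hν hs
    hGker hKker hv hmv (E := fun _ => 0) hD₀c hD₁c hD₀ hD₁
    (fun t _ => (za_sqrt_tsum_zero s t).le) hu₀ hdiv hmean hRc hRd hRge hR0
  refine ⟨u, p, hu, hu0, hmu, fun t ht => ?_⟩
  have h := hb t ht
  have hRt : R t = δ * Real.exp (Λ t - 4 * Real.pi ^ 2 * ν * t) /
      (1 - 2 * Real.pi * Real.sqrt Gsq * δ * Real.exp L *
        (1 - Real.exp (-(4 * Real.pi ^ 2 * ν) * t)) / (4 * Real.pi ^ 2 * ν)) := by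
    show δ * Real.exp (Λ t - μ * t) / (1 - c * (1 - Real.exp (-μ * t))) = _
    rw [hc, ← hμ, ← hG]
    congr 1
    ring_nf
  rw [hRt] at h
  exact h

/-- **Pizzocchero's Thm. 5.1 with the printed bound (5.4)**: under the hypotheses of
`Torus.classicalNS_global_stability_kernels`, for all `t ≥ 0`,
`‖u(t) − v(t)‖_s ≤ e^{L} δ e^{−μt}/(1 − δ/ρ)`, `ρ = (μ/G)e^{−L}`, i.e.
`≤ δ e^{L} e^{−4π²νt}/(1 − 2π√Gsq δ e^{L}/(4π²ν))` — "`‖u(t) − v(t)‖_n ≤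
e^{G_nJ_n + K_nJ_{n+1}} δ_n e^{−νt}/(1 − δ_n/ρ_n)`".
[cite: Pizzocchero2021, Thm. 5.1 (5.4), (5.17)] -/
theorem Torus.classicalNS_global_stability_kernels' (hd : Fintype.card d = 3) {ν : ℝ}
    (hν : 0 < ν) {s : ℝ} (hs : 1 ≤ s)
    {Gsq : ℝ} (hGker : ∀ (k : d → ℤ) (H : Finset (d → ℤ)), ∑ h ∈ H,
      (freqNormSq h * freqNormSq k - (∑ j, (h j : ℝ) * (k j : ℝ)) ^ 2) *
        (freqNormSq k ^ (s / 2) - freqNormSq (k - h) ^ (s / 2)) ^ 2 /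
        (freqNormSq h ^ (s + 1) * freqNormSq (k - h) ^ s) ≤ Gsq)
    {Ksq : ℝ} (hKker : ∀ (k : d → ℤ) (H : Finset (d → ℤ)), ∑ h ∈ H,
      freqNormSq k ^ s * (freqNormSq h * freqNormSq k - (∑ j, (h j : ℝ) * (k j : ℝ)) ^ 2) /
        (freqNormSq h ^ (s + 1) * freqNormSq (k - h) ^ (s + 1)) ≤ Ksq)
    {v : ℝ → UnitAddTorus d → EuclideanSpace ℝ d} {q : ℝ → UnitAddTorus d → ℝ}
    (hv : Torus.IsClassicalNSSolutionOn (Ici 0) ν 0 v q)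
    (hmv : ∀ t ∈ Ici (0 : ℝ), Torus.HasZeroMean (v t))
    {D₀ D₁ : ℝ → ℝ} (hD₀c : ContinuousOn D₀ (Ici 0)) (hD₁c : ContinuousOn D₁ (Ici 0))
    (hD₀ : ∀ t ∈ Ici (0 : ℝ), Real.sqrt (∑' k : d → ℤ, freqNormSq k ^ s *
      ‖mFourierCoeff (EuclideanSpace.complexify ∘ v t) k‖ ^ 2) ≤ D₀ t)
    (hD₁ : ∀ t ∈ Ici (0 : ℝ), Real.sqrt (∑' k : d → ℤ, freqNormSq k ^ (s + 1) *
      ‖mFourierCoeff (EuclideanSpace.complexify ∘ v t) k‖ ^ 2) ≤ D₁ t)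
    {Λ : ℝ → ℝ} {L : ℝ}
    (hΛ : ∀ t ∈ Ici (0 : ℝ), HasDerivWithinAt Λ
      (2 * Real.pi * Real.sqrt Gsq * D₀ t + 2 * Real.pi * Real.sqrt Ksq * D₁ t) (Ici 0) t)
    (hΛ0 : Λ 0 = 0) (hΛL : ∀ t ∈ Ici (0 : ℝ), Λ t ≤ L)
    {u₀ : UnitAddTorus d → EuclideanSpace ℝ d} (hu₀ : Torus.IsSmooth u₀)
    (hdiv : Torus.IsDivFree u₀) (hmean : Torus.HasZeroMean u₀)
    (hclose : 2 * Real.pi * Real.sqrt Gsq * Real.sqrt (∑' k : d → ℤ, freqNormSq k ^ s *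
      ‖mFourierCoeff (EuclideanSpace.complexify ∘ (fun y => u₀ y - v 0 y)) k‖ ^ 2) *
        Real.exp L < 4 * Real.pi ^ 2 * ν) :
    ∃ (u : ℝ → UnitAddTorus d → EuclideanSpace ℝ d) (p : ℝ → UnitAddTorus d → ℝ),
      Torus.IsClassicalNSSolutionOn (Ici 0) ν 0 u p ∧ u 0 = u₀ ∧
      (∀ t ∈ Ici (0 : ℝ), Torus.HasZeroMean (u t)) ∧
      ∀ t ∈ Ici (0 : ℝ), Real.sqrt (∑' k : d → ℤ, freqNormSq k ^ s *
        ‖mFourierCoeff (EuclideanSpace.complexify ∘ (fun y => u t y - v t y)) k‖ ^ 2) ≤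
        Real.sqrt (∑' k : d → ℤ, freqNormSq k ^ s *
          ‖mFourierCoeff (EuclideanSpace.complexify ∘ (fun y => u₀ y - v 0 y)) k‖ ^ 2) *
          Real.exp L * Real.exp (-(4 * Real.pi ^ 2 * ν) * t) /
          (1 - 2 * Real.pi * Real.sqrt Gsq * Real.sqrt (∑' k : d → ℤ, freqNormSq k ^ s *
            ‖mFourierCoeff (EuclideanSpace.complexify ∘ (fun y => u₀ y - v 0 y)) k‖ ^ 2) *
            Real.exp L / (4 * Real.pi ^ 2 * ν)) := by
  obtain ⟨u, p, hu, hu0, hmu, hb⟩ := Torus.classicalNS_global_stability_kernels hd hν hs hGker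
    hKker hv hmv hD₀c hD₁c hD₀ hD₁ hΛ hΛ0 hΛL hu₀ hdiv hmean hclose
  refine ⟨u, p, hu, hu0, hmu, fun t ht => (hb t ht).trans ?_⟩
  set μ : ℝ := 4 * Real.pi ^ 2 * ν with hμ
  have hμ0 : 0 < μ := by rw [hμ]; positivity
  set G : ℝ := 2 * Real.pi * Real.sqrt Gsq with hG
  have hG0 : 0 ≤ G := by rw [hG]; positivity
  set δ : ℝ := Real.sqrt (∑' k : d → ℤ, freqNormSq k ^ s *
    ‖mFourierCoeff (EuclideanSpace.complexify ∘ (fun y => u₀ y - v 0 y)) k‖ ^ 2) with hδ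
  have hδ0 : 0 ≤ δ := Real.sqrt_nonneg _
  have ht0 : 0 ≤ t := mem_Ici.1 ht
  have hq1 : G * δ * Real.exp L / μ < 1 := by rw [div_lt_one hμ0]; exact hclose
  have hq0 : 0 ≤ G * δ * Real.exp L / μ := by positivity
  have he1 : Real.exp (-μ * t) ≤ 1 := by
    rw [Real.exp_le_one_iff]; nlinarith [hμ0]
  have he0 : 0 < Real.exp (-μ * t) := Real.exp_pos _
  -- numerators: `e^{Λ t − μ t} ≤ e^{L} e^{−μ t}`
  have hnum : δ * Real.exp (Λ t - μ * t) ≤ δ * Real.exp L * Real.exp (-μ * t) := by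
    have h1 : Real.exp (Λ t - μ * t) = Real.exp (Λ t) * Real.exp (-μ * t) := by
      rw [← Real.exp_add]; ring_nf
    rw [h1, mul_assoc]
    exact mul_le_mul_of_nonneg_left
      (mul_le_mul_of_nonneg_right (Real.exp_le_exp.2 (hΛL t ht)) he0.le) hδ0
  -- denominators: `1 − q(1 − e^{−μt}) ≥ 1 − q > 0`
  have hden : 1 - G * δ * Real.exp L / μ ≤
      1 - G * δ * Real.exp L * (1 - Real.exp (-μ * t)) / μ := by
    have : G * δ * Real.exp L * (1 - Real.exp (-μ * t)) / μ ≤ G * δ * Real.exp L / μ := by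
      rw [mul_div_right_comm]
      exact mul_le_of_le_one_right hq0 (by linarith)
    linarith
  have hden0 : 0 < 1 - G * δ * Real.exp L / μ := by linarith
  have hn0 : 0 ≤ δ * Real.exp (Λ t - μ * t) := by positivity
  calc δ * Real.exp (Λ t - μ * t) / (1 - G * δ * Real.exp L * (1 - Real.exp (-μ * t)) / μ)
      ≤ δ * Real.exp (Λ t - μ * t) / (1 - G * δ * Real.exp L / μ) :=
        div_le_div_of_nonneg_left hn0 hden0 hden
    _ ≤ δ * Real.exp L * Real.exp (-μ * t) / (1 - G * δ * Real.exp L / μ) :=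
        div_le_div_of_nonneg_right hnum hden0.le

/-- **Pizzocchero's Thm. 5.1 on `T³` at `n = 3`, hypothesis-free constants**: as
`Torus.classicalNS_global_stability_kernels'` with `G = 2π(24ζ₄)^{1/2} ≈ 125`
(`NSSobolev.sum_gramKernel_le_three`) and `K = 2π(B₃ζ₆)^{1/2} ≈ 83`, `B₃ = 2⁸·4⁴/5⁵`
(`NSSobolev.sum_wedgeKernel_le_mpp`): a global classical solution `v` with
`∫₀^∞ (G‖v‖₃ + K‖v‖₄) ≤ L` (through the antiderivative `Λ ≤ L`) is globally stable in `Ḣ³` with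
the explicit radius `ρ = (4π²ν/G)e^{−L}`. For a generalized Beltrami datum `v₀` (`Δv₀ = −κ²v₀`,
exact solution `v(t) = e^{−νκ²t}v₀` in Pizzocchero's units) ibid. §6 evaluates
`ρ_n = (ν/G_n)exp(−(G_n + K_nκ)κ^{n−2}‖v₀‖_{L²}/ν)`.
[cite: Pizzocchero2021, Thm. 5.1, §6 (6.5); MorosiPizzocchero2012Kato, Lemma 5.3; MorosiPerniciPizzocchero2017, Lemma 5.3] -/
theorem Torus.classicalNS_global_stability_three (hd : Fintype.card d = 3) {ν : ℝ}
    (hν : 0 < ν) {s : ℝ} (hs3 : s = 3)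
    {v : ℝ → UnitAddTorus d → EuclideanSpace ℝ d} {q : ℝ → UnitAddTorus d → ℝ}
    (hv : Torus.IsClassicalNSSolutionOn (Ici 0) ν 0 v q)
    (hmv : ∀ t ∈ Ici (0 : ℝ), Torus.HasZeroMean (v t))
    {D₀ D₁ : ℝ → ℝ} (hD₀c : ContinuousOn D₀ (Ici 0)) (hD₁c : ContinuousOn D₁ (Ici 0))
    (hD₀ : ∀ t ∈ Ici (0 : ℝ), Real.sqrt (∑' k : d → ℤ, freqNormSq k ^ s *
      ‖mFourierCoeff (EuclideanSpace.complexify ∘ v t) k‖ ^ 2) ≤ D₀ t)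
    (hD₁ : ∀ t ∈ Ici (0 : ℝ), Real.sqrt (∑' k : d → ℤ, freqNormSq k ^ (s + 1) *
      ‖mFourierCoeff (EuclideanSpace.complexify ∘ v t) k‖ ^ 2) ≤ D₁ t)
    {Λ : ℝ → ℝ} {L : ℝ}
    (hΛ : ∀ t ∈ Ici (0 : ℝ), HasDerivWithinAt Λ
      (2 * Real.pi * Real.sqrt (24 *
          ∑' k : d → ℤ, (if k = 0 then (0 : ℝ) else freqNormSq k ^ (-(s - 1)))) * D₀ t +
        2 * Real.pi * Real.sqrt (((2 : ℝ) ^ (2 * s + 2) * (s + 1) ^ (s + 1) / (s + 2) ^ (s + 2)) *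
          ∑' k : d → ℤ, (if k = 0 then (0 : ℝ) else freqNormSq k ^ (-s))) * D₁ t) (Ici 0) t)
    (hΛ0 : Λ 0 = 0) (hΛL : ∀ t ∈ Ici (0 : ℝ), Λ t ≤ L)
    {u₀ : UnitAddTorus d → EuclideanSpace ℝ d} (hu₀ : Torus.IsSmooth u₀)
    (hdiv : Torus.IsDivFree u₀) (hmean : Torus.HasZeroMean u₀)
    (hclose : 2 * Real.pi * Real.sqrt (24 *
        ∑' k : d → ℤ, (if k = 0 then (0 : ℝ) else freqNormSq k ^ (-(s - 1)))) *
      Real.sqrt (∑' k : d → ℤ, freqNormSq k ^ s *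
        ‖mFourierCoeff (EuclideanSpace.complexify ∘ (fun y => u₀ y - v 0 y)) k‖ ^ 2) *
        Real.exp L < 4 * Real.pi ^ 2 * ν) :
    ∃ (u : ℝ → UnitAddTorus d → EuclideanSpace ℝ d) (p : ℝ → UnitAddTorus d → ℝ),
      Torus.IsClassicalNSSolutionOn (Ici 0) ν 0 u p ∧ u 0 = u₀ ∧
      (∀ t ∈ Ici (0 : ℝ), Torus.HasZeroMean (u t)) ∧
      ∀ t ∈ Ici (0 : ℝ), Real.sqrt (∑' k : d → ℤ, freqNormSq k ^ s *
        ‖mFourierCoeff (EuclideanSpace.complexify ∘ (fun y => u t y - v t y)) k‖ ^ 2) ≤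
        Real.sqrt (∑' k : d → ℤ, freqNormSq k ^ s *
          ‖mFourierCoeff (EuclideanSpace.complexify ∘ (fun y => u₀ y - v 0 y)) k‖ ^ 2) *
          Real.exp L * Real.exp (-(4 * Real.pi ^ 2 * ν) * t) /
          (1 - 2 * Real.pi * Real.sqrt (24 *
              ∑' k : d → ℤ, (if k = 0 then (0 : ℝ) else freqNormSq k ^ (-(s - 1)))) *
            Real.sqrt (∑' k : d → ℤ, freqNormSq k ^ s *
              ‖mFourierCoeff (EuclideanSpace.complexify ∘ (fun y => u₀ y - v 0 y)) k‖ ^ 2) *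
            Real.exp L / (4 * Real.pi ^ 2 * ν)) := by
  classical
  have hn : (Fintype.card d : ℝ) = 3 := by rw [hd]; norm_num
  have hs1 : (1 : ℝ) ≤ s := by rw [hs3]; norm_num
  have hsdG : (Fintype.card d : ℝ) < 2 * (s - 1) := by rw [hn, hs3]; norm_num
  have hsdK : (Fintype.card d : ℝ) < 2 * s := by rw [hn, hs3]; norm_num
  -- `√(24 ζ) = √((√24 … )²)`-free route: feed `Gsq := 24ζ`, `Ksq := B₃ζ₆` directly
  exact Torus.classicalNS_global_stability_kernels' hd hν hs1
    (fun k H => NSSobolev.sum_gramKernel_le_three (d := d) hs3 hsdG k H)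
    (fun k H => NSSobolev.sum_wedgeKernel_le_mpp (d := d) hs1 hsdK k H) hv hmv hD₀c hD₁c hD₀ hD₁
    hΛ hΛ0 hΛL hu₀ hdiv hmean hclose

/-- **Global stability of an exponentially decaying global solution** (Pizzocchero 2021, Thm. 5.1
in the situation of §6 ibid.: `‖v(t)‖_p ≤ ‖v₀‖_p e^{−νκ²t}`, `J_p = ‖v₀‖_p/(νκ²)`): if the global
classical solution `v` obeys `‖v(t)‖_s ≤ M₀e^{−λt}`, `‖v(t)‖_{s+1} ≤ M₁e^{−λt}` (`λ > 0`) then, with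
`G = 2π√Gsq`, `K = 2π√Ksq`, `L := (G M₀ + K M₁)/λ` and `δ = ‖u₀ − v(0)‖_s`, the condition
`G δ e^{L} < 4π²ν` (`δ < ρ = (4π²ν/G)e^{−L}`; ibid. (6.5): `ρ_n = (ν/G_n)e^{−(G_n + K_nκ)κ^{n−2}‖v₀‖/ν}`)
gives a GLOBAL classical solution from `u₀` with
`‖u(t) − v(t)‖_s ≤ δ e^{L} e^{−4π²νt}/(1 − G δ e^{L}/(4π²ν))` for all `t ≥ 0`
(`Torus.classicalNS_global_stability_kernels'` with `D₀ = M₀e^{−λt}`, `D₁ = M₁e^{−λt}`,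
`Λ(t) = (G M₀ + K M₁)(1 − e^{−λt})/λ ≤ L`).
[cite: Pizzocchero2021, Thm. 5.1 with §6 (6.3)–(6.5)] -/
theorem Torus.classicalNS_global_stability_of_exp_decay (hd : Fintype.card d = 3) {ν : ℝ}
    (hν : 0 < ν) {s : ℝ} (hs : 1 ≤ s)
    {Gsq : ℝ} (hGker : ∀ (k : d → ℤ) (H : Finset (d → ℤ)), ∑ h ∈ H,
      (freqNormSq h * freqNormSq k - (∑ j, (h j : ℝ) * (k j : ℝ)) ^ 2) *
        (freqNormSq k ^ (s / 2) - freqNormSq (k - h) ^ (s / 2)) ^ 2 /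
        (freqNormSq h ^ (s + 1) * freqNormSq (k - h) ^ s) ≤ Gsq)
    {Ksq : ℝ} (hKker : ∀ (k : d → ℤ) (H : Finset (d → ℤ)), ∑ h ∈ H,
      freqNormSq k ^ s * (freqNormSq h * freqNormSq k - (∑ j, (h j : ℝ) * (k j : ℝ)) ^ 2) /
        (freqNormSq h ^ (s + 1) * freqNormSq (k - h) ^ (s + 1)) ≤ Ksq)
    {v : ℝ → UnitAddTorus d → EuclideanSpace ℝ d} {q : ℝ → UnitAddTorus d → ℝ}
    (hv : Torus.IsClassicalNSSolutionOn (Ici 0) ν 0 v q)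
    (hmv : ∀ t ∈ Ici (0 : ℝ), Torus.HasZeroMean (v t))
    {M₀ M₁ lam : ℝ} (hlam : 0 < lam) (hM₀ : 0 ≤ M₀) (hM₁ : 0 ≤ M₁)
    (hD₀ : ∀ t ∈ Ici (0 : ℝ), Real.sqrt (∑' k : d → ℤ, freqNormSq k ^ s *
      ‖mFourierCoeff (EuclideanSpace.complexify ∘ v t) k‖ ^ 2) ≤ M₀ * Real.exp (-lam * t))
    (hD₁ : ∀ t ∈ Ici (0 : ℝ), Real.sqrt (∑' k : d → ℤ, freqNormSq k ^ (s + 1) *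
      ‖mFourierCoeff (EuclideanSpace.complexify ∘ v t) k‖ ^ 2) ≤ M₁ * Real.exp (-lam * t))
    {u₀ : UnitAddTorus d → EuclideanSpace ℝ d} (hu₀ : Torus.IsSmooth u₀)
    (hdiv : Torus.IsDivFree u₀) (hmean : Torus.HasZeroMean u₀)
    (hclose : 2 * Real.pi * Real.sqrt Gsq * Real.sqrt (∑' k : d → ℤ, freqNormSq k ^ s *
      ‖mFourierCoeff (EuclideanSpace.complexify ∘ (fun y => u₀ y - v 0 y)) k‖ ^ 2) *
        Real.exp ((2 * Real.pi * Real.sqrt Gsq * M₀ + 2 * Real.pi * Real.sqrt Ksq * M₁) / lam) <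
        4 * Real.pi ^ 2 * ν) :
    ∃ (u : ℝ → UnitAddTorus d → EuclideanSpace ℝ d) (p : ℝ → UnitAddTorus d → ℝ),
      Torus.IsClassicalNSSolutionOn (Ici 0) ν 0 u p ∧ u 0 = u₀ ∧
      (∀ t ∈ Ici (0 : ℝ), Torus.HasZeroMean (u t)) ∧
      ∀ t ∈ Ici (0 : ℝ), Real.sqrt (∑' k : d → ℤ, freqNormSq k ^ s *
        ‖mFourierCoeff (EuclideanSpace.complexify ∘ (fun y => u t y - v t y)) k‖ ^ 2) ≤
        Real.sqrt (∑' k : d → ℤ, freqNormSq k ^ s *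
          ‖mFourierCoeff (EuclideanSpace.complexify ∘ (fun y => u₀ y - v 0 y)) k‖ ^ 2) *
          Real.exp ((2 * Real.pi * Real.sqrt Gsq * M₀ + 2 * Real.pi * Real.sqrt Ksq * M₁) / lam) *
          Real.exp (-(4 * Real.pi ^ 2 * ν) * t) /
          (1 - 2 * Real.pi * Real.sqrt Gsq * Real.sqrt (∑' k : d → ℤ, freqNormSq k ^ s *
            ‖mFourierCoeff (EuclideanSpace.complexify ∘ (fun y => u₀ y - v 0 y)) k‖ ^ 2) *
            Real.exp ((2 * Real.pi * Real.sqrt Gsq * M₀ + 2 * Real.pi * Real.sqrt Ksq * M₁) / lam) /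
            (4 * Real.pi ^ 2 * ν)) := by
  set G : ℝ := 2 * Real.pi * Real.sqrt Gsq with hG
  have hG0 : 0 ≤ G := by rw [hG]; positivity
  set K : ℝ := 2 * Real.pi * Real.sqrt Ksq with hK
  have hK0 : 0 ≤ K := by rw [hK]; positivity
  set A : ℝ := G * M₀ + K * M₁ with hA
  have hA0 : 0 ≤ A := by rw [hA]; positivity
  set Λ : ℝ → ℝ := fun t => A * (1 - Real.exp (-lam * t)) / lam with hΛdef
  have hEc : Continuous fun t : ℝ => Real.exp (-lam * t) :=
    Real.continuous_exp.comp (continuous_const.mul continuous_id)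
  have hD₀c : ContinuousOn (fun t : ℝ => M₀ * Real.exp (-lam * t)) (Ici 0) :=
    (continuous_const.mul hEc).continuousOn
  have hD₁c : ContinuousOn (fun t : ℝ => M₁ * Real.exp (-lam * t)) (Ici 0) :=
    (continuous_const.mul hEc).continuousOn
  have hΛ : ∀ t ∈ Ici (0 : ℝ), HasDerivWithinAt Λ
      (2 * Real.pi * Real.sqrt Gsq * (fun t : ℝ => M₀ * Real.exp (-lam * t)) t +
        2 * Real.pi * Real.sqrt Ksq * (fun t : ℝ => M₁ * Real.exp (-lam * t)) t) (Ici 0) t := by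
    intro t _
    have hlin : HasDerivAt (fun τ : ℝ => -lam * τ) (-lam) t := by
      simpa using (hasDerivAt_id t).const_mul (-lam)
    have h1 : HasDerivAt Λ (A * (-(Real.exp (-lam * t) * (-lam))) / lam) t :=
      ((hlin.exp.const_sub 1).const_mul A).div_const lam
    refine (h1.hasDerivWithinAt).congr_deriv ?_
    show A * (-(Real.exp (-lam * t) * (-lam))) / lam =
      2 * Real.pi * Real.sqrt Gsq * (M₀ * Real.exp (-lam * t)) +
        2 * Real.pi * Real.sqrt Ksq * (M₁ * Real.exp (-lam * t))
    rw [hA, hG, hK]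
    field_simp
  have hΛ0 : Λ 0 = 0 := by
    show A * (1 - Real.exp (-lam * 0)) / lam = 0
    simp
  have hΛL : ∀ t ∈ Ici (0 : ℝ), Λ t ≤ A / lam := by
    intro t _
    show A * (1 - Real.exp (-lam * t)) / lam ≤ A / lam
    have h1 : A * (1 - Real.exp (-lam * t)) ≤ A :=
      mul_le_of_le_one_right hA0 (by linarith [Real.exp_pos (-lam * t)])
    exact div_le_div_of_nonneg_right h1 hlam.le
  have hclose' : 2 * Real.pi * Real.sqrt Gsq * Real.sqrt (∑' k : d → ℤ, freqNormSq k ^ s *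
      ‖mFourierCoeff (EuclideanSpace.complexify ∘ (fun y => u₀ y - v 0 y)) k‖ ^ 2) *
        Real.exp (A / lam) < 4 * Real.pi ^ 2 * ν := by
    rw [hA, hG, hK]; exact hclose
  have h := Torus.classicalNS_global_stability_kernels' hd hν hs hGker hKker hv hmv hD₀c hD₁c hD₀
    hD₁ hΛ hΛ0 hΛL hu₀ hdiv hmean hclose'
  rw [hA, hG, hK] at h
  exact h

/-- **Global stability of an exponentially decaying solution on `T³` at `n = 3`, hypothesis-free
constants** (`G = 2π(24ζ₄)^{1/2} ≈ 125`, `K = 2π(B₃ζ₆)^{1/2} ≈ 83`): `‖v(t)‖₃ ≤ M₀e^{−λt}`,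
`‖v(t)‖₄ ≤ M₁e^{−λt}`, `L = (G M₀ + K M₁)/λ`; `G‖u₀ − v(0)‖₃e^{L} < 4π²ν ⇒` the solution from `u₀`
is global with `‖u(t) − v(t)‖₃ ≤ δe^{L}e^{−4π²νt}/(1 − Gδe^{L}/(4π²ν))`. For a shear datum
`v₀ = A sin(2πk·x)`, `A·k = 0` (an exact solution `v(t) = e^{−4π²|k|²νt}v₀` of any amplitude):
`λ = 4π²|k|²ν`, `M₀ = ‖v₀‖₃ = |k|³‖A‖/√2`, `M₁ = ‖v₀‖₄ = |k| M₀` (Pizzocchero §6; typed in §6 below,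
`Torus.classicalNS_global_stability_shearWave_three`).
[cite: Pizzocchero2021, Thm. 5.1, §6 (6.5); MorosiPizzocchero2012Kato, Lemma 5.3; MorosiPerniciPizzocchero2017, Lemma 5.3] -/
theorem Torus.classicalNS_global_stability_of_exp_decay_three (hd : Fintype.card d = 3) {ν : ℝ}
    (hν : 0 < ν) {s : ℝ} (hs3 : s = 3)
    {v : ℝ → UnitAddTorus d → EuclideanSpace ℝ d} {q : ℝ → UnitAddTorus d → ℝ}
    (hv : Torus.IsClassicalNSSolutionOn (Ici 0) ν 0 v q)
    (hmv : ∀ t ∈ Ici (0 : ℝ), Torus.HasZeroMean (v t))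
    {M₀ M₁ lam : ℝ} (hlam : 0 < lam) (hM₀ : 0 ≤ M₀) (hM₁ : 0 ≤ M₁)
    (hD₀ : ∀ t ∈ Ici (0 : ℝ), Real.sqrt (∑' k : d → ℤ, freqNormSq k ^ s *
      ‖mFourierCoeff (EuclideanSpace.complexify ∘ v t) k‖ ^ 2) ≤ M₀ * Real.exp (-lam * t))
    (hD₁ : ∀ t ∈ Ici (0 : ℝ), Real.sqrt (∑' k : d → ℤ, freqNormSq k ^ (s + 1) *
      ‖mFourierCoeff (EuclideanSpace.complexify ∘ v t) k‖ ^ 2) ≤ M₁ * Real.exp (-lam * t))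
    {u₀ : UnitAddTorus d → EuclideanSpace ℝ d} (hu₀ : Torus.IsSmooth u₀)
    (hdiv : Torus.IsDivFree u₀) (hmean : Torus.HasZeroMean u₀)
    (hclose : 2 * Real.pi * Real.sqrt (24 *
        ∑' k : d → ℤ, (if k = 0 then (0 : ℝ) else freqNormSq k ^ (-(s - 1)))) *
      Real.sqrt (∑' k : d → ℤ, freqNormSq k ^ s *
        ‖mFourierCoeff (EuclideanSpace.complexify ∘ (fun y => u₀ y - v 0 y)) k‖ ^ 2) *
        Real.exp ((2 * Real.pi * Real.sqrt (24 *
            ∑' k : d → ℤ, (if k = 0 then (0 : ℝ) else freqNormSq k ^ (-(s - 1)))) * M₀ +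
          2 * Real.pi * Real.sqrt (((2 : ℝ) ^ (2 * s + 2) * (s + 1) ^ (s + 1) / (s + 2) ^ (s + 2)) *
            ∑' k : d → ℤ, (if k = 0 then (0 : ℝ) else freqNormSq k ^ (-s))) * M₁) / lam) <
        4 * Real.pi ^ 2 * ν) :
    ∃ (u : ℝ → UnitAddTorus d → EuclideanSpace ℝ d) (p : ℝ → UnitAddTorus d → ℝ),
      Torus.IsClassicalNSSolutionOn (Ici 0) ν 0 u p ∧ u 0 = u₀ ∧
      (∀ t ∈ Ici (0 : ℝ), Torus.HasZeroMean (u t)) ∧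
      ∀ t ∈ Ici (0 : ℝ), Real.sqrt (∑' k : d → ℤ, freqNormSq k ^ s *
        ‖mFourierCoeff (EuclideanSpace.complexify ∘ (fun y => u t y - v t y)) k‖ ^ 2) ≤
        Real.sqrt (∑' k : d → ℤ, freqNormSq k ^ s *
          ‖mFourierCoeff (EuclideanSpace.complexify ∘ (fun y => u₀ y - v 0 y)) k‖ ^ 2) *
          Real.exp ((2 * Real.pi * Real.sqrt (24 *
              ∑' k : d → ℤ, (if k = 0 then (0 : ℝ) else freqNormSq k ^ (-(s - 1)))) * M₀ +
            2 * Real.pi * Real.sqrt (((2 : ℝ) ^ (2 * s + 2) * (s + 1) ^ (s + 1) / (s + 2) ^ (s + 2)) *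
              ∑' k : d → ℤ, (if k = 0 then (0 : ℝ) else freqNormSq k ^ (-s))) * M₁) / lam) *
          Real.exp (-(4 * Real.pi ^ 2 * ν) * t) /
          (1 - 2 * Real.pi * Real.sqrt (24 *
              ∑' k : d → ℤ, (if k = 0 then (0 : ℝ) else freqNormSq k ^ (-(s - 1)))) *
            Real.sqrt (∑' k : d → ℤ, freqNormSq k ^ s *
              ‖mFourierCoeff (EuclideanSpace.complexify ∘ (fun y => u₀ y - v 0 y)) k‖ ^ 2) *
            Real.exp ((2 * Real.pi * Real.sqrt (24 *
                ∑' k : d → ℤ, (if k = 0 then (0 : ℝ) else freqNormSq k ^ (-(s - 1)))) * M₀ +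
              2 * Real.pi * Real.sqrt (((2 : ℝ) ^ (2 * s + 2) * (s + 1) ^ (s + 1) / (s + 2) ^ (s + 2)) *
                ∑' k : d → ℤ, (if k = 0 then (0 : ℝ) else freqNormSq k ^ (-s))) * M₁) / lam) /
            (4 * Real.pi ^ 2 * ν)) := by
  classical
  have hn : (Fintype.card d : ℝ) = 3 := by rw [hd]; norm_num
  have hs1 : (1 : ℝ) ≤ s := by rw [hs3]; norm_num
  have hsdG : (Fintype.card d : ℝ) < 2 * (s - 1) := by rw [hn, hs3]; norm_num
  have hsdK : (Fintype.card d : ℝ) < 2 * s := by rw [hn, hs3]; norm_num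
  exact Torus.classicalNS_global_stability_of_exp_decay hd hν hs1
    (fun k H => NSSobolev.sum_gramKernel_le_three (d := d) hs3 hsdG k H)
    (fun k H => NSSobolev.sum_wedgeKernel_le_mpp (d := d) hs1 hsdK k H) hv hmv hlam hM₀ hM₁ hD₀ hD₁
    hu₀ hdiv hmean hclose

/-! ### §5 Generalized Beltrami references (Pizzocchero 2021, §6) -/

omit [DecidableEq d] in
/-- Fourier coefficients of a real multiple: `𝓕(c w)(k) = c 𝓕(w)(k)`. [folklore] -/
private theorem za_mFourierCoeff_complexify_const_smul (c : ℝ)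
    (w : UnitAddTorus d → EuclideanSpace ℝ d) (k : d → ℤ) :
    mFourierCoeff (EuclideanSpace.complexify ∘ (c • w)) k =
      (c : ℂ) • mFourierCoeff (EuclideanSpace.complexify ∘ w) k := by
  have h : (⇑(EuclideanSpace.complexify (ι := d)) ∘ (c • w)) =
      (c : ℂ) • (⇑(EuclideanSpace.complexify (ι := d)) ∘ w) := by
    funext x
    simp only [Function.comp_apply, Pi.smul_apply, LinearIsometry.map_smul, Complex.coe_smul]
  rw [h, mFourierCoeff_const_smul]

omit [DecidableEq d] in
/-- The `Ḣ^s` functional of a nonnegative multiple: `‖c w‖_s = c ‖w‖_s` (`c ≥ 0`). [folklore] -/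
private theorem za_sqrt_tsum_const_smul {c : ℝ} (hc : 0 ≤ c)
    (w : UnitAddTorus d → EuclideanSpace ℝ d) (s : ℝ) :
    Real.sqrt (∑' k : d → ℤ, freqNormSq k ^ s *
      ‖mFourierCoeff (EuclideanSpace.complexify ∘ (c • w)) k‖ ^ 2) =
      c * Real.sqrt (∑' k : d → ℤ, freqNormSq k ^ s *
        ‖mFourierCoeff (EuclideanSpace.complexify ∘ w) k‖ ^ 2) := by
  have h : ∀ k : d → ℤ, freqNormSq k ^ s *
      ‖mFourierCoeff (EuclideanSpace.complexify ∘ (c • w)) k‖ ^ 2 =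
      c ^ 2 * (freqNormSq k ^ s * ‖mFourierCoeff (EuclideanSpace.complexify ∘ w) k‖ ^ 2) := by
    intro k
    rw [za_mFourierCoeff_complexify_const_smul, norm_smul, Complex.norm_real, Real.norm_eq_abs,
      abs_of_nonneg hc]
    ring
  simp_rw [h]
  rw [tsum_mul_left, Real.sqrt_mul (sq_nonneg c), Real.sqrt_sq hc]

/-- **A generalized Beltrami datum gives an explicit global, decaying classical solution**
(Pizzocchero 2021, §6, (6.1)–(6.3): "`Δv₀ = −κ²v₀`, `𝓛((v₀·∇)v₀) = 0` … the NS Cauchy problem with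
initial datum `v₀` has the global, decaying solution `v(t) = e^{−κ²νt}v₀`"): on the unit torus, if
`w` is smooth and divergence free with `Δw = −c w` and `(w·∇)w = ∇θ` for a smooth `θ` (Beltrami
fields: `θ = |w|²/2`; shear fields `A sin(2πk·x)`, `A·k = 0`: `θ = 0`, `c = 4π²|k|²`), then
`v(t) = e^{−νct} w` with pressure `q(t) = −e^{−2νct} θ` is a classical solution of the unforced
equations on `[0, ∞)`. [cite: Pizzocchero2021, §6 (6.1)–(6.3)] -/
theorem Torus.isClassicalNSSolutionOn_expDecay_of_eigen {ν c : ℝ}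
    {w : UnitAddTorus d → EuclideanSpace ℝ d} (hw : Torus.IsSmooth w) (hdiv : Torus.IsDivFree w)
    (hlap : ∀ x, Torus.laplacian w x = -(c • w x))
    {θ : UnitAddTorus d → ℝ} (hθ : Torus.IsSmooth θ)
    (hconv : ∀ x, Torus.convect w w x = Torus.gradient θ x) :
    Torus.IsClassicalNSSolutionOn (Ici 0) ν 0 (fun t x => Real.exp (-(ν * c) * t) • w x)
      (fun t x => (-(Real.exp (-(ν * c) * t) ^ 2)) * θ x) where
  smooth_velocity :=
    (isSmoothSpaceTimeOn_of_time (θ := fun t : ℝ => Real.exp (-(ν * c) * t))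
      ((Real.contDiff_exp.comp (contDiff_const.mul contDiff_id)).contDiffOn)).smul
      (isSmoothSpaceTimeOn_const hw _)
  smooth_pressure :=
    (isSmoothSpaceTimeOn_of_time (θ := fun t : ℝ => -(Real.exp (-(ν * c) * t) ^ 2))
      (((Real.contDiff_exp.comp (contDiff_const.mul contDiff_id)).pow 2).neg.contDiffOn)).mul
      (isSmoothSpaceTimeOn_const hθ _)
  momentum t ht x := by
    set e : ℝ := Real.exp (-(ν * c) * t) with he
    have hw1 : Torus.IsContDiff 1 w := hw.isContDiff (by simp)
    have hθ1 : Torus.IsContDiff 1 θ := hθ.isContDiff (by simp)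
    -- the time derivative
    have h1 : Torus.timeDerivWithin (Ici 0) (fun t x => Real.exp (-(ν * c) * t) • w x) t x =
        (e * (-(ν * c))) • w x := by
      have hlin : HasDerivAt (fun τ : ℝ => -(ν * c) * τ) (-(ν * c)) t := by
        simpa using (hasDerivAt_id t).const_mul (-(ν * c))
      have hd : HasDerivAt (fun τ : ℝ => Real.exp (-(ν * c) * τ) • w x)
          ((Real.exp (-(ν * c) * t) * (-(ν * c))) • w x) t := hlin.exp.smul_const (w x)
      exact hd.hasDerivWithinAt.derivWithin (uniqueDiffOn_Ici 0 t ht)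
    -- the convection term
    have h2 : Torus.convect (fun x => e • w x) (fun x => e • w x) x =
        e • (e • Torus.gradient θ x) := by
      show Torus.fderiv (e • w) x ((e • w) x) = _
      rw [fderiv_const_smul hw1 e x, FunLike.coe_smul, Pi.smul_apply, Pi.smul_apply,
        map_smul, ← hconv x]
      rfl
    -- the Laplacian
    have h3 : Torus.laplacian (fun x => e • w x) x = e • (-(c • w x)) := by
      show Torus.laplacian (e • w) x = _
      rw [laplacian_const_smul_apply hw e x, hlap x]
    -- the pressure gradient
    have h4 : Torus.gradient (fun x => (-(e ^ 2)) * θ x) x = (-(e ^ 2)) • Torus.gradient θ x := by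
      show Torus.gradient ((-(e ^ 2)) • θ) x = _
      exact Torus.gradient_const_smul hθ1 _ x
    rw [h1]
    show (e * (-(ν * c))) • w x + Torus.convect (fun x => e • w x) (fun x => e • w x) x =
      ν • Torus.laplacian (fun x => e • w x) x - Torus.gradient (fun x => (-(e ^ 2)) * θ x) x + 0
    rw [h2, h3, h4]
    module
  divFree t _ x := by
    show Torus.divergence (Real.exp (-(ν * c) * t) • w) x = 0
    exact Torus.isDivFree_const_smul (hw.isContDiff (by simp)) hdiv _ x

/-- **Global stability of generalized Beltrami flows on `T³`, hypothesis-free constants**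
(Pizzocchero 2021, Thm. 5.1 with §6: "Any datum `u₀ ∈ H^∞_{Σ0}` with `‖u₀ − v₀‖_n < ρ_n` produces
a global, decaying solution `u`", `ρ_n = (ν/G_n)exp(−(G_n + K_nκ)κ^{n−2}‖v₀‖_{L²}/ν)`): for a
smooth divergence-free mean-zero `w` on the unit torus with `Δw = −c w` (`c > 0`) and
`(w·∇)w = ∇θ`, the exact solution `v(t) = e^{−νct}w` of
`Torus.isClassicalNSSolutionOn_expDecay_of_eigen` is globally stable in `Ḣ³`: with
`G = 2π(24ζ₄)^{1/2} ≈ 125`, `K = 2π(B₃ζ₆)^{1/2} ≈ 83`, `M₀ = ‖w‖₃`, `M₁ = ‖w‖₄`,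
`L = (G M₀ + K M₁)/(νc)`, every smooth divergence-free mean-zero `u₀` with
`G ‖u₀ − w‖₃ e^{L} < 4π²ν` gives a GLOBAL classical solution with
`‖u(t) − e^{−νct}w‖₃ ≤ δe^{L}e^{−4π²νt}/(1 − Gδe^{L}/(4π²ν))` (`Torus.classicalNS_global_stability_of_exp_decay_three`).
For the shear datum `w = A sin(2πk·x)`, `A·k = 0`: `c = 4π²|k|²`, `M₀ = |k|³‖A‖/√2`, `M₁ = |k| M₀`,
any amplitude (§6 below, `Torus.classicalNS_global_stability_shearWave_three`).
[cite: Pizzocchero2021, Thm. 5.1, §6 (6.1)–(6.7); MorosiPizzocchero2012Kato, Lemma 5.3; MorosiPerniciPizzocchero2017, Lemma 5.3] -/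
theorem Torus.classicalNS_global_stability_of_eigen_three (hd : Fintype.card d = 3) {ν : ℝ}
    (hν : 0 < ν) {s : ℝ} (hs3 : s = 3) {c : ℝ} (hc : 0 < c)
    {w : UnitAddTorus d → EuclideanSpace ℝ d} (hw : Torus.IsSmooth w) (hdivw : Torus.IsDivFree w)
    (hmw : Torus.HasZeroMean w) (hlap : ∀ x, Torus.laplacian w x = -(c • w x))
    {θ : UnitAddTorus d → ℝ} (hθ : Torus.IsSmooth θ)
    (hconv : ∀ x, Torus.convect w w x = Torus.gradient θ x)
    {u₀ : UnitAddTorus d → EuclideanSpace ℝ d} (hu₀ : Torus.IsSmooth u₀)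
    (hdiv : Torus.IsDivFree u₀) (hmean : Torus.HasZeroMean u₀)
    (hclose : 2 * Real.pi * Real.sqrt (24 *
        ∑' k : d → ℤ, (if k = 0 then (0 : ℝ) else freqNormSq k ^ (-(s - 1)))) *
      Real.sqrt (∑' k : d → ℤ, freqNormSq k ^ s *
        ‖mFourierCoeff (EuclideanSpace.complexify ∘ (fun y => u₀ y - w y)) k‖ ^ 2) *
        Real.exp ((2 * Real.pi * Real.sqrt (24 *
            ∑' k : d → ℤ, (if k = 0 then (0 : ℝ) else freqNormSq k ^ (-(s - 1)))) *
            Real.sqrt (∑' k : d → ℤ, freqNormSq k ^ s *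
              ‖mFourierCoeff (EuclideanSpace.complexify ∘ w) k‖ ^ 2) +
          2 * Real.pi * Real.sqrt (((2 : ℝ) ^ (2 * s + 2) * (s + 1) ^ (s + 1) / (s + 2) ^ (s + 2)) *
            ∑' k : d → ℤ, (if k = 0 then (0 : ℝ) else freqNormSq k ^ (-s))) *
            Real.sqrt (∑' k : d → ℤ, freqNormSq k ^ (s + 1) *
              ‖mFourierCoeff (EuclideanSpace.complexify ∘ w) k‖ ^ 2)) / (ν * c)) <
        4 * Real.pi ^ 2 * ν) :
    ∃ (u : ℝ → UnitAddTorus d → EuclideanSpace ℝ d) (p : ℝ → UnitAddTorus d → ℝ),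
      Torus.IsClassicalNSSolutionOn (Ici 0) ν 0 u p ∧ u 0 = u₀ ∧
      (∀ t ∈ Ici (0 : ℝ), Torus.HasZeroMean (u t)) ∧
      ∀ t ∈ Ici (0 : ℝ), Real.sqrt (∑' k : d → ℤ, freqNormSq k ^ s *
        ‖mFourierCoeff (EuclideanSpace.complexify ∘
          (fun y => u t y - Real.exp (-(ν * c) * t) • w y)) k‖ ^ 2) ≤
        Real.sqrt (∑' k : d → ℤ, freqNormSq k ^ s *
          ‖mFourierCoeff (EuclideanSpace.complexify ∘ (fun y => u₀ y - w y)) k‖ ^ 2) *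
          Real.exp ((2 * Real.pi * Real.sqrt (24 *
              ∑' k : d → ℤ, (if k = 0 then (0 : ℝ) else freqNormSq k ^ (-(s - 1)))) *
              Real.sqrt (∑' k : d → ℤ, freqNormSq k ^ s *
                ‖mFourierCoeff (EuclideanSpace.complexify ∘ w) k‖ ^ 2) +
            2 * Real.pi * Real.sqrt (((2 : ℝ) ^ (2 * s + 2) * (s + 1) ^ (s + 1) / (s + 2) ^ (s + 2)) *
              ∑' k : d → ℤ, (if k = 0 then (0 : ℝ) else freqNormSq k ^ (-s))) *
              Real.sqrt (∑' k : d → ℤ, freqNormSq k ^ (s + 1) *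
                ‖mFourierCoeff (EuclideanSpace.complexify ∘ w) k‖ ^ 2)) / (ν * c)) *
          Real.exp (-(4 * Real.pi ^ 2 * ν) * t) /
          (1 - 2 * Real.pi * Real.sqrt (24 *
              ∑' k : d → ℤ, (if k = 0 then (0 : ℝ) else freqNormSq k ^ (-(s - 1)))) *
            Real.sqrt (∑' k : d → ℤ, freqNormSq k ^ s *
              ‖mFourierCoeff (EuclideanSpace.complexify ∘ (fun y => u₀ y - w y)) k‖ ^ 2) *
            Real.exp ((2 * Real.pi * Real.sqrt (24 *
                ∑' k : d → ℤ, (if k = 0 then (0 : ℝ) else freqNormSq k ^ (-(s - 1)))) *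
                Real.sqrt (∑' k : d → ℤ, freqNormSq k ^ s *
                  ‖mFourierCoeff (EuclideanSpace.complexify ∘ w) k‖ ^ 2) +
              2 * Real.pi * Real.sqrt (((2 : ℝ) ^ (2 * s + 2) * (s + 1) ^ (s + 1) / (s + 2) ^ (s + 2)) *
                ∑' k : d → ℤ, (if k = 0 then (0 : ℝ) else freqNormSq k ^ (-s))) *
                Real.sqrt (∑' k : d → ℤ, freqNormSq k ^ (s + 1) *
                  ‖mFourierCoeff (EuclideanSpace.complexify ∘ w) k‖ ^ 2)) / (ν * c)) /
            (4 * Real.pi ^ 2 * ν)) := by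
  classical
  set v : ℝ → UnitAddTorus d → EuclideanSpace ℝ d := fun t x => Real.exp (-(ν * c) * t) • w x
    with hvdef
  have hv : Torus.IsClassicalNSSolutionOn (Ici 0) ν 0 v
      (fun t x => (-(Real.exp (-(ν * c) * t) ^ 2)) * θ x) :=
    Torus.isClassicalNSSolutionOn_expDecay_of_eigen hw hdivw hlap hθ hconv
  have hmv : ∀ t ∈ Ici (0 : ℝ), Torus.HasZeroMean (v t) := by
    intro t _
    show Torus.HasZeroMean (Real.exp (-(ν * c) * t) • w)
    exact Torus.hasZeroMean_const_smul hmw _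
  have hlam : 0 < ν * c := mul_pos hν hc
  have hX : ∀ (r : ℝ), ∀ t ∈ Ici (0 : ℝ), Real.sqrt (∑' k : d → ℤ, freqNormSq k ^ r *
      ‖mFourierCoeff (EuclideanSpace.complexify ∘ v t) k‖ ^ 2) ≤
      Real.sqrt (∑' k : d → ℤ, freqNormSq k ^ r *
        ‖mFourierCoeff (EuclideanSpace.complexify ∘ w) k‖ ^ 2) * Real.exp (-(ν * c) * t) := by
    intro r t _
    have hvt : v t = Real.exp (-(ν * c) * t) • w := rfl
    rw [hvt, za_sqrt_tsum_const_smul (Real.exp_pos _).le w r, mul_comm]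
  have hfun : (fun y => u₀ y - v 0 y) = fun y => u₀ y - w y := by
    funext y; simp [hvdef]
  have hclose' := hclose
  rw [← hfun] at hclose'
  have h := Torus.classicalNS_global_stability_of_exp_decay_three hd hν hs3 hv hmv hlam
    (Real.sqrt_nonneg _) (Real.sqrt_nonneg _) (hX s) (hX (s + 1)) hu₀ hdiv hmean hclose'
  rw [hfun] at h
  exact h

/-! ### §6 The trigonometric shear datum (Pizzocchero 2021, §6 (6.6)–(6.7)) -/

omit [DecidableEq d] in
/-- A single real mode with transversal vector is pointwise orthogonal to its frequency:
`k · z = 0 ⟹ k · Re (e_k(x) z) = 0`. [folklore] -/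
private theorem za_sum_mul_realTrigPoly_singleton_apply_eq_zero {k : d → ℤ}
    {c : (d → ℤ) → EuclideanSpace ℂ d} (hz : ∑ j, (k j : ℂ) * c k j = 0) (x : UnitAddTorus d) :
    ∑ j, (k j : ℝ) * realTrigPoly {k} c x j = 0 := by
  have h1 : ∀ j, (k j : ℝ) * realTrigPoly {k} c x j =
      ((k j : ℂ) * (mFourier k x * c k j)).re := by
    intro j
    rw [realTrigPoly_singleton_apply, EuclideanSpace.realPart_apply, PiLp.smul_apply, smul_eq_mul,
      show ((k j : ℂ)) = ((k j : ℝ) : ℂ) by norm_cast, Complex.re_ofReal_mul]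
  simp_rw [h1]
  rw [← Complex.re_sum]
  have h2 : ∑ j, (k j : ℂ) * (mFourier k x * c k j) = mFourier k x * ∑ j, (k j : ℂ) * c k j := by
    rw [Finset.mul_sum]
    exact Finset.sum_congr rfl fun j _ => by ring
  rw [h2, hz, mul_zero, Complex.zero_re]

/-- **The convective derivative of a single real mode along a field orthogonal to its frequency
vanishes**: `k · u(x) = 0 ⟹ ((u·∇) Re (e_k z))(x) = 0` (`∂ⱼ Re (e_k z) = Re (2πi kⱼ e_k z)`, so
`(u·∇) Re (e_k z) = Re (2πi (k · u) e_k z)`). [folklore] -/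
private theorem za_convect_realTrigPoly_singleton_eq_zero (u : UnitAddTorus d → EuclideanSpace ℝ d)
    (k : d → ℤ) (c : (d → ℤ) → EuclideanSpace ℂ d) {x : UnitAddTorus d}
    (hx : ∑ j, (k j : ℝ) * u x j = 0) :
    Torus.convect u (realTrigPoly {k} c) x = 0 := by
  have ha : IsContDiff 1 (realTrigPoly {k} c) :=
    (isSmooth_realTrigPoly {k} c).isContDiff (by simp)
  unfold Torus.convect
  rw [fderiv_apply_eq_sum_partialDeriv ha]
  simp_rw [partialDeriv_realTrigPoly, realTrigPoly_singleton_apply]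
  have h1 : ∀ i, (u x i) • EuclideanSpace.realPart
      (mFourier k x • ((2 * Real.pi * Complex.I * (k i : ℂ)) • c k)) =
      EuclideanSpace.realPart (((u x i : ℝ) : ℂ) •
        (mFourier k x • ((2 * Real.pi * Complex.I * (k i : ℂ)) • c k))) := by
    intro i
    rw [Complex.coe_smul]
    exact (EuclideanSpace.realPart.map_smul (u x i) _).symm
  simp_rw [h1]
  rw [← map_sum]
  have h2 : ∑ i, ((u x i : ℝ) : ℂ) •
      (mFourier k x • ((2 * Real.pi * Complex.I * (k i : ℂ)) • c k)) =
      (2 * Real.pi * Complex.I * mFourier k x * ((∑ j, (k j : ℝ) * u x j : ℝ) : ℂ)) • c k := by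
    simp_rw [smul_smul, ← Finset.sum_smul]
    congr 1
    push_cast
    rw [Finset.mul_sum]
    exact Finset.sum_congr rfl fun i _ => by ring
  rw [h2, hx]
  simp

/-- **A transversal single real mode has no self-convection**: `k · z = 0 ⟹
((w·∇)w)(x) = 0` for `w = Re (e_k z)` — the nonlinearity of the shear datum vanishes
(Pizzocchero 2021, (6.6): "`((v₀·∇)v₀)(x) = (2π)^{−d}(A·k)A sin(2k·x) = 0`"). [cite: Pizzocchero2021, §6 (6.6)] -/
theorem Torus.convect_realTrigPoly_singleton_self_eq_zero {k : d → ℤ}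
    {c : (d → ℤ) → EuclideanSpace ℂ d} (hz : ∑ j, (k j : ℂ) * c k j = 0) (x : UnitAddTorus d) :
    Torus.convect (realTrigPoly {k} c) (realTrigPoly {k} c) x = 0 :=
  za_convect_realTrigPoly_singleton_eq_zero _ k c
    (za_sum_mul_realTrigPoly_singleton_apply_eq_zero hz x)

omit [DecidableEq d] in
/-- A single real mode with `k ≠ 0` has zero mean (`∫ e_k = 0`). [folklore] -/
private theorem za_hasZeroMean_realTrigPoly_singleton {k : d → ℤ} (hk : k ≠ 0)
    (c : (d → ℤ) → EuclideanSpace ℂ d) : HasZeroMean (realTrigPoly {k} c) := by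
  unfold HasZeroMean
  have h1 : (fun x => realTrigPoly {k} c x) =
      fun x => EuclideanSpace.realPart (mFourier k x • c k) :=
    funext fun x => realTrigPoly_singleton_apply k c x
  have hint : Integrable (fun x : UnitAddTorus d => mFourier k x • c k) volume :=
    ((mFourier k).continuous.smul continuous_const).integrable_unitAddTorus
  rw [h1, ContinuousLinearMap.integral_comp_comm _ hint, integral_smul_const, integral_mFourier,
    if_neg hk, zero_smul, map_zero]

omit [DecidableEq d] in
/-- The gradient of the zero scalar vanishes. [folklore] -/
private theorem za_gradient_zero (x : UnitAddTorus d) :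
    Torus.gradient (fun _ : UnitAddTorus d => (0 : ℝ)) x = 0 := by
  unfold Torus.gradient liftAt
  simp [_root_.gradient]

omit [Fintype d] [DecidableEq d] in
/-- `k ≠ 0 ⟹ -k ≠ k` in `ℤ^d`. [folklore] -/
private theorem za_neg_ne_self {k : d → ℤ} (hk : k ≠ 0) : -k ≠ k := by
  intro h
  apply hk
  funext i
  have hi := congrFun h i
  simp only [Pi.neg_apply] at hi
  have : k i = 0 := by omega
  simpa using this

/-- **The `Ḣ^s` functionals of a single real mode** (`k ≠ 0`):
`∑_m |m|^{2s} |𝓕(Re (e_k z))(m)|² = |k|^{2s} ‖z‖²/2` (the coefficients are `z/2` at `k`, `z̄/2`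
at `−k`; Pizzocchero 2021, (6.2)/(6.7): `‖v₀‖_p = κ^p‖v₀‖_{L²}`). [cite: Pizzocchero2021, §6 (6.2), (6.7)] -/
theorem Torus.tsum_rpow_mul_norm_sq_mFourierCoeff_realTrigPoly_singleton {k : d → ℤ} (hk : k ≠ 0)
    (c : (d → ℤ) → EuclideanSpace ℂ d) (s : ℝ) :
    ∑' m : d → ℤ, freqNormSq m ^ s *
      ‖mFourierCoeff (EuclideanSpace.complexify ∘ realTrigPoly {k} c) m‖ ^ 2 =
      freqNormSq k ^ s * (‖c k‖ ^ 2 / 2) := by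
  have hne : -k ≠ k := za_neg_ne_self hk
  have hcoef : ∀ m : d → ℤ, ‖mFourierCoeff (EuclideanSpace.complexify ∘ realTrigPoly {k} c) m‖ =
      if m = k ∨ m = -k then ‖c k‖ / 2 else 0 := by
    intro m
    rw [mFourierCoeff_realTrigPoly_singleton]
    by_cases h1 : m = k
    · have h2 : m ≠ -k := fun h => hne (h ▸ h1.symm ▸ rfl)
      rw [if_pos h1, if_neg h2, if_pos (Or.inl h1), EuclideanSpace.conjVec_zero, add_zero,
        norm_smul, norm_inv, Complex.norm_ofNat]
      ring
    · by_cases h2 : m = -k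
      · rw [if_neg h1, if_pos h2, if_pos (Or.inr h2), zero_add, norm_smul, norm_inv,
          Complex.norm_ofNat, EuclideanSpace.norm_conjVec]
        ring
      · rw [if_neg h1, if_neg h2, if_neg (not_or.2 ⟨h1, h2⟩), EuclideanSpace.conjVec_zero,
          add_zero, smul_zero, norm_zero]
  simp_rw [hcoef]
  rw [tsum_eq_sum (s := ({k, -k} : Finset (d → ℤ))) fun m hm => by
    rw [Finset.mem_insert, Finset.mem_singleton, not_or] at hm
    rw [if_neg (not_or.2 ⟨hm.1, hm.2⟩)]; ring]
  rw [Finset.sum_pair hne.symm, if_pos (Or.inl rfl), if_pos (Or.inr rfl), freqNormSq_neg]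
  ring

/-- Square-root form: `‖Re (e_k z)‖_s = |k|^s ‖z‖/√2`, `|k| = (freqNormSq k)^{1/2}`. [cite: Pizzocchero2021, §6 (6.7)] -/
theorem Torus.sqrt_tsum_rpow_mul_norm_sq_mFourierCoeff_realTrigPoly_singleton {k : d → ℤ}
    (hk : k ≠ 0) (c : (d → ℤ) → EuclideanSpace ℂ d) (s : ℝ) :
    Real.sqrt (∑' m : d → ℤ, freqNormSq m ^ s *
      ‖mFourierCoeff (EuclideanSpace.complexify ∘ realTrigPoly {k} c) m‖ ^ 2) =
      Real.sqrt (freqNormSq k) ^ s * ‖c k‖ / Real.sqrt 2 := by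
  have hx : 0 ≤ freqNormSq k := freqNormSq_nonneg k
  have h : Real.sqrt (freqNormSq k ^ s) = Real.sqrt (freqNormSq k) ^ s := by
    rw [Real.sqrt_eq_rpow, Real.sqrt_eq_rpow, ← Real.rpow_mul hx, ← Real.rpow_mul hx, mul_comm]
  rw [Torus.tsum_rpow_mul_norm_sq_mFourierCoeff_realTrigPoly_singleton hk,
    Real.sqrt_mul (Real.rpow_nonneg hx s), h, Real.sqrt_div (sq_nonneg _),
    Real.sqrt_sq (norm_nonneg _)]
  ring

/-- **The transversal single real mode is an exact, exponentially decaying Navier–Stokes solution**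
(Pizzocchero 2021, §6, (6.1), (6.3), (6.6): the shear datum `v₀ = A sin(k·x)`, `A·k = 0`, is a
generalized Beltrami flow, `Δv₀ = −κ²v₀`, `(v₀·∇)v₀ = 0`, and "the NS Cauchy problem with initial
datum `v₀` has the global, decaying solution `v(t) = e^{−κ²νt}v₀`"): on the unit torus `T^d`, for
`k ∈ ℤ^d` and `z ∈ ℂ^d` with `k · z = 0`, the field `w = Re (e_k z)` (`e_k(x) = e^{2πik·x}`;
`z = −iA`, `A ∈ ℝ^d`, gives `A sin(2πk·x)`) generates the classical solution
`v(t, x) = e^{−4π²|k|²νt} w(x)` with zero pressure of the unforced equations on `[0, ∞)`, for every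
`ν` (`Torus.isClassicalNSSolutionOn_expDecay_of_eigen` with `c = 4π²|k|²`, `θ = 0`).
[cite: Pizzocchero2021, §6 (6.1)–(6.3), (6.6)] -/
theorem Torus.isClassicalNSSolutionOn_expDecay_realTrigPoly_singleton (ν : ℝ) {k₀ : d → ℤ}
    {c : (d → ℤ) → EuclideanSpace ℂ d} (hz : ∑ j, (k₀ j : ℂ) * c k₀ j = 0) :
    Torus.IsClassicalNSSolutionOn (Ici 0) ν 0
      (fun t x => Real.exp (-(ν * (4 * Real.pi ^ 2 * freqNormSq k₀)) * t) • realTrigPoly {k₀} c x)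
      (fun _ _ => 0) := by
  have h := Torus.isClassicalNSSolutionOn_expDecay_of_eigen (ν := ν)
    (c := 4 * Real.pi ^ 2 * freqNormSq k₀) (isSmooth_realTrigPoly {k₀} c)
    (isDivFree_realTrigPoly_singleton hz)
    (fun x => by rw [laplacian_realTrigPoly_singleton, neg_smul]) (isSmooth_const (0 : ℝ))
    (fun x => by rw [Torus.convect_realTrigPoly_singleton_self_eq_zero hz, za_gradient_zero])
  have hp : (fun (t : ℝ) (_ : UnitAddTorus d) =>
      (-(Real.exp (-(ν * (4 * Real.pi ^ 2 * freqNormSq k₀)) * t) ^ 2)) * (0 : ℝ)) =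
      fun _ _ => (0 : ℝ) := by
    funext t x; ring
  rw [hp] at h
  exact h

/-- **Global stability of the transversal single real mode on `T³`, hypothesis-free constants**
(Pizzocchero 2021, Thm. 5.1 with §6 (6.4)–(6.7): for the generalized Beltrami datum `v₀`,
`J_p = κ^{p−2}‖v₀‖_{L²}/ν`, `ρ_n = (ν/G_n) exp(−(G_n + K_nκ)κ^{n−2}‖v₀‖_{L²}/ν)`, and "any datum
`u₀ ∈ H^∞_{Σ0}` with `‖u₀ − v₀‖_n < ρ_n` produces a global, decaying solution `u`" with the bounds
(5.4); (6.7): `κ = |k|`, `‖v₀‖_p = |k|^p‖v₀‖_{L²}`, "so `‖v₀‖_p` can be arbitrarily large"): on the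
unit torus `T³` (`|k| = (freqNormSq k)^{1/2}`, `‖w‖_s = |k|^s‖z‖/√2` for `w = Re (e_k z)`,
`Torus.sqrt_tsum_rpow_mul_norm_sq_mFourierCoeff_realTrigPoly_singleton`), for `k ≠ 0`, `k · z = 0`,
with `G = 2π(24ζ₄)^{1/2} ≈ 125`, `K = 2π(B₃ζ₆)^{1/2} ≈ 83` and
`L = (G|k|³ + K|k|⁴)(‖z‖/√2)/(4π²|k|²ν) = (G + K|k|)|k|‖z‖/(4√2π²ν)`, every smooth divergence-free
mean-zero `u₀` with `G‖u₀ − w‖₃e^{L} < 4π²ν` gives a GLOBAL classical solution with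
`‖u(t) − e^{−4π²|k|²νt}w‖₃ ≤ δe^{L}e^{−4π²νt}/(1 − Gδe^{L}/(4π²ν))`, `δ = ‖u₀ − w‖₃` — any amplitude
`‖z‖`, any frequency `k ≠ 0` (`Torus.classicalNS_global_stability_of_eigen_three`).
[cite: Pizzocchero2021, Thm. 5.1, §6 (6.4)–(6.7); MorosiPizzocchero2012Kato, Lemma 5.3; MorosiPerniciPizzocchero2017, Lemma 5.3] -/
theorem Torus.classicalNS_global_stability_realTrigPoly_singleton_three (hd : Fintype.card d = 3)
    {ν : ℝ} (hν : 0 < ν) {s : ℝ} (hs3 : s = 3) {k₀ : d → ℤ} (hk : k₀ ≠ 0)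
    {c : (d → ℤ) → EuclideanSpace ℂ d} (hz : ∑ j, (k₀ j : ℂ) * c k₀ j = 0)
    {u₀ : UnitAddTorus d → EuclideanSpace ℝ d} (hu₀ : Torus.IsSmooth u₀)
    (hdiv : Torus.IsDivFree u₀) (hmean : Torus.HasZeroMean u₀)
    (hclose : 2 * Real.pi * Real.sqrt (24 *
        ∑' m : d → ℤ, (if m = 0 then (0 : ℝ) else freqNormSq m ^ (-(s - 1)))) *
      Real.sqrt (∑' m : d → ℤ, freqNormSq m ^ s *
        ‖mFourierCoeff (EuclideanSpace.complexify ∘ (fun y => u₀ y - realTrigPoly {k₀} c y)) m‖ ^ 2) *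
        Real.exp ((2 * Real.pi * Real.sqrt (24 *
            ∑' m : d → ℤ, (if m = 0 then (0 : ℝ) else freqNormSq m ^ (-(s - 1)))) *
            (Real.sqrt (freqNormSq k₀) ^ s * ‖c k₀‖ / Real.sqrt 2) +
          2 * Real.pi * Real.sqrt (((2 : ℝ) ^ (2 * s + 2) * (s + 1) ^ (s + 1) / (s + 2) ^ (s + 2)) *
            ∑' m : d → ℤ, (if m = 0 then (0 : ℝ) else freqNormSq m ^ (-s))) *
            (Real.sqrt (freqNormSq k₀) ^ (s + 1) * ‖c k₀‖ / Real.sqrt 2)) / (ν * (4 * Real.pi ^ 2 * freqNormSq k₀))) <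
        4 * Real.pi ^ 2 * ν) :
    ∃ (u : ℝ → UnitAddTorus d → EuclideanSpace ℝ d) (p : ℝ → UnitAddTorus d → ℝ),
      Torus.IsClassicalNSSolutionOn (Ici 0) ν 0 u p ∧ u 0 = u₀ ∧
      (∀ t ∈ Ici (0 : ℝ), Torus.HasZeroMean (u t)) ∧
      ∀ t ∈ Ici (0 : ℝ), Real.sqrt (∑' m : d → ℤ, freqNormSq m ^ s *
        ‖mFourierCoeff (EuclideanSpace.complexify ∘
          (fun y => u t y - Real.exp (-(ν * (4 * Real.pi ^ 2 * freqNormSq k₀)) * t) •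
            realTrigPoly {k₀} c y)) m‖ ^ 2) ≤
        Real.sqrt (∑' m : d → ℤ, freqNormSq m ^ s *
          ‖mFourierCoeff (EuclideanSpace.complexify ∘ (fun y => u₀ y - realTrigPoly {k₀} c y)) m‖ ^ 2) *
          Real.exp ((2 * Real.pi * Real.sqrt (24 *
              ∑' m : d → ℤ, (if m = 0 then (0 : ℝ) else freqNormSq m ^ (-(s - 1)))) *
              (Real.sqrt (freqNormSq k₀) ^ s * ‖c k₀‖ / Real.sqrt 2) +
            2 * Real.pi * Real.sqrt (((2 : ℝ) ^ (2 * s + 2) * (s + 1) ^ (s + 1) / (s + 2) ^ (s + 2)) *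
              ∑' m : d → ℤ, (if m = 0 then (0 : ℝ) else freqNormSq m ^ (-s))) *
              (Real.sqrt (freqNormSq k₀) ^ (s + 1) * ‖c k₀‖ / Real.sqrt 2)) / (ν * (4 * Real.pi ^ 2 * freqNormSq k₀))) *
          Real.exp (-(4 * Real.pi ^ 2 * ν) * t) /
          (1 - 2 * Real.pi * Real.sqrt (24 *
              ∑' m : d → ℤ, (if m = 0 then (0 : ℝ) else freqNormSq m ^ (-(s - 1)))) *
            Real.sqrt (∑' m : d → ℤ, freqNormSq m ^ s *
              ‖mFourierCoeff (EuclideanSpace.complexify ∘ (fun y => u₀ y - realTrigPoly {k₀} c y)) m‖ ^ 2) *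
            Real.exp ((2 * Real.pi * Real.sqrt (24 *
                ∑' m : d → ℤ, (if m = 0 then (0 : ℝ) else freqNormSq m ^ (-(s - 1)))) *
                (Real.sqrt (freqNormSq k₀) ^ s * ‖c k₀‖ / Real.sqrt 2) +
              2 * Real.pi * Real.sqrt (((2 : ℝ) ^ (2 * s + 2) * (s + 1) ^ (s + 1) / (s + 2) ^ (s + 2)) *
                ∑' m : d → ℤ, (if m = 0 then (0 : ℝ) else freqNormSq m ^ (-s))) *
                (Real.sqrt (freqNormSq k₀) ^ (s + 1) * ‖c k₀‖ / Real.sqrt 2)) / (ν * (4 * Real.pi ^ 2 * freqNormSq k₀))) /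
            (4 * Real.pi ^ 2 * ν)) := by
  have hcpos : 0 < 4 * Real.pi ^ 2 * freqNormSq k₀ :=
    mul_pos (by positivity) (lt_of_lt_of_le one_pos (one_le_freqNormSq_of_ne_zero hk))
  have hn0 := Torus.sqrt_tsum_rpow_mul_norm_sq_mFourierCoeff_realTrigPoly_singleton hk c s
  have hn1 := Torus.sqrt_tsum_rpow_mul_norm_sq_mFourierCoeff_realTrigPoly_singleton hk c (s + 1)
  have h := Torus.classicalNS_global_stability_of_eigen_three hd hν hs3 hcpos
    (isSmooth_realTrigPoly {k₀} c) (isDivFree_realTrigPoly_singleton hz)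
    (za_hasZeroMean_realTrigPoly_singleton hk c)
    (fun x => by rw [laplacian_realTrigPoly_singleton, neg_smul]) (isSmooth_const (0 : ℝ))
    (fun x => by rw [Torus.convect_realTrigPoly_singleton_self_eq_zero hz, za_gradient_zero])
    hu₀ hdiv hmean (by rw [hn0, hn1]; exact hclose)
  rw [hn0, hn1] at h
  exact h

omit [DecidableEq d] in
/-- **The sine shear mode as a single real mode**: `Re (e_k(x) (−iA)) = sin(2πk·x) A` for real `A`
(`e_k(x) = e^{2πik·x}`, `Im e_k(x) = sin(2πk·x)`; Pizzocchero 2021, (6.6): `v₀(x) = c_d A sin(k·x)`).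
[cite: Pizzocchero2021, §6 (6.6)] -/
theorem Torus.realTrigPoly_singleton_neg_I_smul_complexify (k₀ : d → ℤ) (A : EuclideanSpace ℝ d)
    (x : UnitAddTorus d) :
    realTrigPoly {k₀} (fun _ => (-Complex.I) • EuclideanSpace.complexify A) x =
      (mFourier k₀ x).im • A := by
  rw [realTrigPoly_singleton_apply]
  ext j
  simp only [EuclideanSpace.realPart_apply, PiLp.smul_apply, smul_eq_mul,
    EuclideanSpace.complexify_apply, Complex.mul_re, Complex.neg_re, Complex.neg_im,
    Complex.I_re, Complex.I_im, Complex.ofReal_re, Complex.ofReal_im, Complex.mul_im]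
  ring

omit [DecidableEq d] in
/-- Transversality of the sine shear coefficient: `A · k = 0 ⟹ k · (−iA) = 0`. [folklore] -/
private theorem za_sum_mul_neg_I_smul_complexify_eq_zero {k₀ : d → ℤ} {A : EuclideanSpace ℝ d}
    (hA : ∑ j, (k₀ j : ℝ) * A j = 0) :
    ∑ j, (k₀ j : ℂ) * ((-Complex.I) • EuclideanSpace.complexify A) j = 0 := by
  simp only [PiLp.smul_apply, smul_eq_mul, EuclideanSpace.complexify_apply]
  have h : ∑ j, (k₀ j : ℂ) * (-Complex.I * (A j : ℂ)) =
      -Complex.I * ((∑ j, (k₀ j : ℝ) * A j : ℝ) : ℂ) := by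
    push_cast
    rw [Finset.mul_sum]
    exact Finset.sum_congr rfl fun j _ => by ring
  rw [h, hA, Complex.ofReal_zero, mul_zero]

omit [DecidableEq d] in
/-- `‖−iA‖ = ‖A‖` (`complexify` is an isometry). [folklore] -/
private theorem za_norm_neg_I_smul_complexify (A : EuclideanSpace ℝ d) :
    ‖(-Complex.I) • EuclideanSpace.complexify A‖ = ‖A‖ := by
  rw [norm_smul, norm_neg, Complex.norm_I, one_mul, EuclideanSpace.norm_complexify]

/-- **Pizzocchero's shear datum `A sin(2πk·x)`, `A·k = 0`, is an exact decaying Navier–Stokes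
solution on `T^d`** (Pizzocchero 2021, §6 (6.6), (6.3): "`div v₀ = 0` due to `A·k = 0`;
`P(v₀, v₀) = −𝓛((v₀·∇)v₀)` vanishes because `((v₀·∇)v₀)(x) = (2π)^{−d}(A·k)A sin(2k·x) = 0`",
`v(t) = e^{−κ²νt}v₀`): `v(t, x) = e^{−4π²|k|²νt} sin(2πk·x) A`, with zero pressure, is a classical
solution of the unforced equations on `[0, ∞)` for every `ν`, `k ∈ ℤ^d` and `A ⊥ k`
(`sin(2πk·x) = Im e_k(x)`). [cite: Pizzocchero2021, §6 (6.3), (6.6)] -/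
theorem Torus.isClassicalNSSolutionOn_shearWave (ν : ℝ) {k₀ : d → ℤ} {A : EuclideanSpace ℝ d}
    (hA : ∑ j, (k₀ j : ℝ) * A j = 0) :
    Torus.IsClassicalNSSolutionOn (Ici 0) ν 0
      (fun t x => Real.exp (-(ν * (4 * Real.pi ^ 2 * freqNormSq k₀)) * t) • (mFourier k₀ x).im • A)
      (fun _ _ => 0) := by
  have h := Torus.isClassicalNSSolutionOn_expDecay_realTrigPoly_singleton ν (k₀ := k₀)
    (c := fun _ => (-Complex.I) • EuclideanSpace.complexify A)
    (za_sum_mul_neg_I_smul_complexify_eq_zero hA)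
  simp only [Torus.realTrigPoly_singleton_neg_I_smul_complexify] at h
  exact h

/-- **Global stability of Pizzocchero's shear flow `e^{−4π²|k|²νt} A sin(2πk·x)` on `T³`,
hypothesis-free constants, any amplitude** (Pizzocchero 2021, Thm. 5.1 with §6 (6.5)–(6.7):
`ρ_n = (ν/G_n)exp(−(G_n + K_nκ)κ^{n−2}‖v₀‖_{L²}/ν)`, `κ = |k|`, `‖v₀‖_{L²} = |A|`, "so, for each
real `p`, `‖v₀‖_p` can be arbitrarily large"): on the unit torus `T³` with the tree's functional
`‖w‖_s² = ∑_m |m|^{2s}‖ŵ(m)‖²` one has `‖A sin(2πk·x)‖_s = |k|^s‖A‖/√2`; with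
`G = 2π(24ζ₄)^{1/2} ≈ 125`, `K = 2π(B₃ζ₆)^{1/2} ≈ 83`, `L = (G + K|k|)|k|‖A‖/(4√2π²ν)` and
`δ = ‖u₀ − A sin(2πk·x)‖₃`, every smooth divergence-free mean-zero `u₀` with `Gδe^{L} < 4π²ν` gives
a GLOBAL classical solution with
`‖u(t) − e^{−4π²|k|²νt}A sin(2πk·x)‖₃ ≤ δe^{L}e^{−4π²νt}/(1 − Gδe^{L}/(4π²ν))` for all `t ≥ 0`
(`k ≠ 0`, `A·k = 0`; `Torus.classicalNS_global_stability_realTrigPoly_singleton_three` with `z = −iA`).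
[cite: Pizzocchero2021, Thm. 5.1, §6 (6.5)–(6.7); MorosiPizzocchero2012Kato, Lemma 5.3; MorosiPerniciPizzocchero2017, Lemma 5.3] -/
theorem Torus.classicalNS_global_stability_shearWave_three (hd : Fintype.card d = 3)
    {ν : ℝ} (hν : 0 < ν) {s : ℝ} (hs3 : s = 3) {k₀ : d → ℤ} (hk : k₀ ≠ 0)
    {A : EuclideanSpace ℝ d} (hA : ∑ j, (k₀ j : ℝ) * A j = 0)
    {u₀ : UnitAddTorus d → EuclideanSpace ℝ d} (hu₀ : Torus.IsSmooth u₀)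
    (hdiv : Torus.IsDivFree u₀) (hmean : Torus.HasZeroMean u₀)
    (hclose : 2 * Real.pi * Real.sqrt (24 *
        ∑' m : d → ℤ, (if m = 0 then (0 : ℝ) else freqNormSq m ^ (-(s - 1)))) *
      Real.sqrt (∑' m : d → ℤ, freqNormSq m ^ s *
        ‖mFourierCoeff (EuclideanSpace.complexify ∘ (fun y => u₀ y - (mFourier k₀ y).im • A)) m‖ ^ 2) *
        Real.exp ((2 * Real.pi * Real.sqrt (24 *
            ∑' m : d → ℤ, (if m = 0 then (0 : ℝ) else freqNormSq m ^ (-(s - 1)))) *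
            (Real.sqrt (freqNormSq k₀) ^ s * ‖A‖ / Real.sqrt 2) +
          2 * Real.pi * Real.sqrt (((2 : ℝ) ^ (2 * s + 2) * (s + 1) ^ (s + 1) / (s + 2) ^ (s + 2)) *
            ∑' m : d → ℤ, (if m = 0 then (0 : ℝ) else freqNormSq m ^ (-s))) *
            (Real.sqrt (freqNormSq k₀) ^ (s + 1) * ‖A‖ / Real.sqrt 2)) / (ν * (4 * Real.pi ^ 2 * freqNormSq k₀))) <
        4 * Real.pi ^ 2 * ν) :
    ∃ (u : ℝ → UnitAddTorus d → EuclideanSpace ℝ d) (p : ℝ → UnitAddTorus d → ℝ),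
      Torus.IsClassicalNSSolutionOn (Ici 0) ν 0 u p ∧ u 0 = u₀ ∧
      (∀ t ∈ Ici (0 : ℝ), Torus.HasZeroMean (u t)) ∧
      ∀ t ∈ Ici (0 : ℝ), Real.sqrt (∑' m : d → ℤ, freqNormSq m ^ s *
        ‖mFourierCoeff (EuclideanSpace.complexify ∘
          (fun y => u t y - Real.exp (-(ν * (4 * Real.pi ^ 2 * freqNormSq k₀)) * t) • (mFourier k₀ y).im • A)) m‖ ^ 2) ≤
        Real.sqrt (∑' m : d → ℤ, freqNormSq m ^ s *
          ‖mFourierCoeff (EuclideanSpace.complexify ∘ (fun y => u₀ y - (mFourier k₀ y).im • A)) m‖ ^ 2) *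
          Real.exp ((2 * Real.pi * Real.sqrt (24 *
              ∑' m : d → ℤ, (if m = 0 then (0 : ℝ) else freqNormSq m ^ (-(s - 1)))) *
              (Real.sqrt (freqNormSq k₀) ^ s * ‖A‖ / Real.sqrt 2) +
            2 * Real.pi * Real.sqrt (((2 : ℝ) ^ (2 * s + 2) * (s + 1) ^ (s + 1) / (s + 2) ^ (s + 2)) *
              ∑' m : d → ℤ, (if m = 0 then (0 : ℝ) else freqNormSq m ^ (-s))) *
              (Real.sqrt (freqNormSq k₀) ^ (s + 1) * ‖A‖ / Real.sqrt 2)) / (ν * (4 * Real.pi ^ 2 * freqNormSq k₀))) *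
          Real.exp (-(4 * Real.pi ^ 2 * ν) * t) /
          (1 - 2 * Real.pi * Real.sqrt (24 *
              ∑' m : d → ℤ, (if m = 0 then (0 : ℝ) else freqNormSq m ^ (-(s - 1)))) *
            Real.sqrt (∑' m : d → ℤ, freqNormSq m ^ s *
              ‖mFourierCoeff (EuclideanSpace.complexify ∘ (fun y => u₀ y - (mFourier k₀ y).im • A)) m‖ ^ 2) *
            Real.exp ((2 * Real.pi * Real.sqrt (24 *
                ∑' m : d → ℤ, (if m = 0 then (0 : ℝ) else freqNormSq m ^ (-(s - 1)))) *
                (Real.sqrt (freqNormSq k₀) ^ s * ‖A‖ / Real.sqrt 2) +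
              2 * Real.pi * Real.sqrt (((2 : ℝ) ^ (2 * s + 2) * (s + 1) ^ (s + 1) / (s + 2) ^ (s + 2)) *
                ∑' m : d → ℤ, (if m = 0 then (0 : ℝ) else freqNormSq m ^ (-s))) *
                (Real.sqrt (freqNormSq k₀) ^ (s + 1) * ‖A‖ / Real.sqrt 2)) / (ν * (4 * Real.pi ^ 2 * freqNormSq k₀))) /
            (4 * Real.pi ^ 2 * ν)) := by
  have h := Torus.classicalNS_global_stability_realTrigPoly_singleton_three hd hν hs3 hk
    (c := fun _ => (-Complex.I) • EuclideanSpace.complexify A)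
    (za_sum_mul_neg_I_smul_complexify_eq_zero hA) hu₀ hdiv hmean
    (by
      simp only [Torus.realTrigPoly_singleton_neg_I_smul_complexify,
        za_norm_neg_I_smul_complexify]
      exact hclose)
  simp only [Torus.realTrigPoly_singleton_neg_I_smul_complexify,
    za_norm_neg_I_smul_complexify] at h
  exact h

/-! ### §7 Numeric forms: the lattice sums `ζ₄(ℤ³) ≤ 16.6213`, `ζ₆(ℤ³) ≤ 8.4034` inserted -/

omit [Fintype d] [DecidableEq d] in
/-- Monotonicity plumbing for the closeness hypotheses. [folklore] -/
private theorem za_mono_close {G K G' K' δ a₀ a₁ den c : ℝ} (hG : G ≤ G') (hK : K ≤ K')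
    (hG0 : 0 ≤ G) (hδ : 0 ≤ δ) (ha₀ : 0 ≤ a₀) (ha₁ : 0 ≤ a₁) (hden : 0 < den)
    (h : G' * δ * Real.exp ((G' * a₀ + K' * a₁) / den) < c) :
    G * δ * Real.exp ((G * a₀ + K * a₁) / den) < c := by
  refine lt_of_le_of_lt ?_ h
  have hG' : 0 ≤ G' := hG0.trans hG
  gcongr

omit [DecidableEq d] in
/-- **The hypothesis-free Kato constant at `n = 3` is a number: `G = 2π(24ζ₄(ℤ³))^{1/2} ≤ 125.5`**
(`ζ₄(ℤ³) = ∑'_{k≠0}|k|⁻⁴ ≤ 16.6213`, `CubicLatticeInversePowerSums`; Jones–Ingham's printed value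
`16.5323` gives `125.16`). [cite: JonesIngham1925, Table I (simple cubic, A₄ = 16.5323); MorosiPizzocchero2012Kato, Lemma 5.3] -/
theorem Torus.katoConst_three_le (hd : Fintype.card d = 3) {s : ℝ} (hs3 : s = 3) :
    2 * Real.pi * Real.sqrt (24 *
        ∑' k : d → ℤ, (if k = 0 then (0 : ℝ) else freqNormSq k ^ (-(s - 1)))) ≤ 125.5 := by
  subst hs3
  have h2 : ∀ k : d → ℤ, (if k = 0 then (0 : ℝ) else freqNormSq k ^ (-((3 : ℝ) - 1))) =
      (if k = 0 then (0 : ℝ) else freqNormSq k ^ (-(2 : ℝ))) := fun k => by norm_num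
  simp_rw [h2]
  have hz := tsum_ite_freqNormSq_rpow_neg_two_le_three hd
  have hs : Real.sqrt (24 * ∑' k : d → ℤ, (if k = 0 then (0 : ℝ) else freqNormSq k ^ (-(2 : ℝ)))) ≤
      19.973 := by
    rw [show (19.973 : ℝ) = Real.sqrt (19.973 ^ 2) by rw [Real.sqrt_sq (by norm_num)]]
    exact Real.sqrt_le_sqrt (by nlinarith)
  have hπ := Real.pi_lt_d6
  nlinarith [Real.sqrt_nonneg (24 * ∑' k : d → ℤ, (if k = 0 then (0 : ℝ) else freqNormSq k ^ (-(2 : ℝ)))),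
    Real.pi_pos]

omit [DecidableEq d] in
/-- **The hypothesis-free transport constant at `n = 3` is a number:
`K = 2π((2⁸4⁴/5⁵)ζ₆(ℤ³))^{1/2} ≤ 83.5`** (`ζ₆(ℤ³) = ∑'_{k≠0}|k|⁻⁶ ≤ 8.4034`; the printed
`8.40192` gives `83.40`). [cite: JonesIngham1925, Table I (simple cubic, A₆ = 8.40192); MorosiPerniciPizzocchero2017, Lemma 5.3] -/
theorem Torus.transportConst_three_le (hd : Fintype.card d = 3) {s : ℝ} (hs3 : s = 3) :
    2 * Real.pi * Real.sqrt (((2 : ℝ) ^ (2 * s + 2) * (s + 1) ^ (s + 1) / (s + 2) ^ (s + 2)) *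
        ∑' k : d → ℤ, (if k = 0 then (0 : ℝ) else freqNormSq k ^ (-s))) ≤ 83.5 := by
  subst hs3
  have hB : (2 : ℝ) ^ (2 * (3 : ℝ) + 2) * ((3 : ℝ) + 1) ^ ((3 : ℝ) + 1) / ((3 : ℝ) + 2) ^ ((3 : ℝ) + 2) =
      65536 / 3125 := by
    rw [show 2 * (3 : ℝ) + 2 = ((8 : ℕ) : ℝ) by norm_num, show (3 : ℝ) + 1 = ((4 : ℕ) : ℝ) by norm_num,
      show (3 : ℝ) + 2 = ((5 : ℕ) : ℝ) by norm_num, Real.rpow_natCast, Real.rpow_natCast,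
      Real.rpow_natCast]
    norm_num
  rw [hB]
  have hz := tsum_ite_freqNormSq_rpow_neg_three_le_three hd
  have hs : Real.sqrt (65536 / 3125 *
      ∑' k : d → ℤ, (if k = 0 then (0 : ℝ) else freqNormSq k ^ (-(3 : ℝ)))) ≤ 13.2755 := by
    rw [show (13.2755 : ℝ) = Real.sqrt (13.2755 ^ 2) by rw [Real.sqrt_sq (by norm_num)]]
    exact Real.sqrt_le_sqrt (by nlinarith)
  have hπ := Real.pi_lt_d6
  nlinarith [Real.sqrt_nonneg (65536 / 3125 *
      ∑' k : d → ℤ, (if k = 0 then (0 : ℝ) else freqNormSq k ^ (-(3 : ℝ)))), Real.pi_pos]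

/-- **MP 2015 Prop. 5.1 at `n = 3` with numeric constant**: `125.5 · ‖u₀‖₃ · T < 1 ⇒` the
classical solution from `u₀` exists on `[0, T]` (`Torus.classicalNS_regular_of_hsNorm_three` with
`G ≤ 125.5`). [cite: MorosiPizzocchero2015, Prop. 5.1; JonesIngham1925, Table I] -/
theorem Torus.classicalNS_regular_of_hsNorm_three_numeric (hd : Fintype.card d = 3) {ν : ℝ}
    (hν : 0 < ν) {T : ℝ} (hT : 0 < T) {s : ℝ} (hs3 : s = 3)
    {u₀ : UnitAddTorus d → EuclideanSpace ℝ d} (hu₀ : Torus.IsSmooth u₀)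
    (hdiv : Torus.IsDivFree u₀) (hmean : Torus.HasZeroMean u₀)
    (hT1 : 125.5 * Real.sqrt (∑' k : d → ℤ, freqNormSq k ^ s *
        ‖mFourierCoeff (EuclideanSpace.complexify ∘ u₀) k‖ ^ 2) * T < 1) :
    ∃ (u : ℝ → UnitAddTorus d → EuclideanSpace ℝ d) (p : ℝ → UnitAddTorus d → ℝ),
      Torus.IsClassicalNSSolutionOn (Icc 0 T) ν 0 u p ∧ u 0 = u₀ ∧
      (∀ t ∈ Icc 0 T, Torus.HasZeroMean (u t)) ∧
      ∀ t ∈ Icc 0 T, Real.sqrt (∑' k : d → ℤ, freqNormSq k ^ s *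
        ‖mFourierCoeff (EuclideanSpace.complexify ∘ u t) k‖ ^ 2) ≤
        Real.sqrt (∑' k : d → ℤ, freqNormSq k ^ s *
          ‖mFourierCoeff (EuclideanSpace.complexify ∘ u₀) k‖ ^ 2) *
          Real.exp (-(4 * Real.pi ^ 2 * ν) * t) /
          (1 - 2 * Real.pi * Real.sqrt (24 *
              ∑' k : d → ℤ, (if k = 0 then (0 : ℝ) else freqNormSq k ^ (-(s - 1)))) *
            Real.sqrt (∑' k : d → ℤ, freqNormSq k ^ s *
              ‖mFourierCoeff (EuclideanSpace.complexify ∘ u₀) k‖ ^ 2) *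
            (1 - Real.exp (-(4 * Real.pi ^ 2 * ν) * t)) / (4 * Real.pi ^ 2 * ν)) := by
  refine Torus.classicalNS_regular_of_hsNorm_three hd hν hT hs3 hu₀ hdiv hmean ?_
  have hG := Torus.katoConst_three_le hd hs3
  have hX := Real.sqrt_nonneg (∑' k : d → ℤ, freqNormSq k ^ s *
        ‖mFourierCoeff (EuclideanSpace.complexify ∘ u₀) k‖ ^ 2)
  have hG0 : 0 ≤ 2 * Real.pi * Real.sqrt (24 *
        ∑' k : d → ℤ, (if k = 0 then (0 : ℝ) else freqNormSq k ^ (-(s - 1)))) := by positivity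
  nlinarith [mul_le_mul_of_nonneg_right hG (mul_nonneg hX hT.le)]

/-- **Small-data global existence at `n = 3` with numeric constant**: `125.5 · ‖u₀‖₃ ≤ 4π²ν ⇒`
GLOBAL classical solution with exponential `Ḣ³` decay (`Torus.classicalNS_global_of_hsNorm_three`
with `G ≤ 125.5`; MP 2015 Prop. 5.1 "if `‖u₀‖_n ≤ ν/G_n`, `u` is global").
[cite: MorosiPizzocchero2015, Prop. 5.1; JonesIngham1925, Table I] -/
theorem Torus.classicalNS_global_of_hsNorm_three_numeric (hd : Fintype.card d = 3) {ν : ℝ}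
    (hν : 0 < ν) {s : ℝ} (hs3 : s = 3)
    {u₀ : UnitAddTorus d → EuclideanSpace ℝ d} (hu₀ : Torus.IsSmooth u₀)
    (hdiv : Torus.IsDivFree u₀) (hmean : Torus.HasZeroMean u₀)
    (hsmall : 125.5 * Real.sqrt (∑' k : d → ℤ, freqNormSq k ^ s *
        ‖mFourierCoeff (EuclideanSpace.complexify ∘ u₀) k‖ ^ 2) ≤ 4 * Real.pi ^ 2 * ν) :
    ∃ (u : ℝ → UnitAddTorus d → EuclideanSpace ℝ d) (p : ℝ → UnitAddTorus d → ℝ),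
      Torus.IsClassicalNSSolutionOn (Ici 0) ν 0 u p ∧ u 0 = u₀ ∧
      (∀ t ∈ Ici (0 : ℝ), Torus.HasZeroMean (u t)) ∧
      ∀ t ∈ Ici (0 : ℝ), Real.sqrt (∑' k : d → ℤ, freqNormSq k ^ s *
        ‖mFourierCoeff (EuclideanSpace.complexify ∘ u t) k‖ ^ 2) ≤
        Real.sqrt (∑' k : d → ℤ, freqNormSq k ^ s *
          ‖mFourierCoeff (EuclideanSpace.complexify ∘ u₀) k‖ ^ 2) *
          Real.exp (-(4 * Real.pi ^ 2 * ν) * t) /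
          (1 - 2 * Real.pi * Real.sqrt (24 *
              ∑' k : d → ℤ, (if k = 0 then (0 : ℝ) else freqNormSq k ^ (-(s - 1)))) *
            Real.sqrt (∑' k : d → ℤ, freqNormSq k ^ s *
              ‖mFourierCoeff (EuclideanSpace.complexify ∘ u₀) k‖ ^ 2) *
            (1 - Real.exp (-(4 * Real.pi ^ 2 * ν) * t)) / (4 * Real.pi ^ 2 * ν)) := by
  refine Torus.classicalNS_global_of_hsNorm_three hd hν hs3 hu₀ hdiv hmean ?_
  have hG := Torus.katoConst_three_le hd hs3
  have hX := Real.sqrt_nonneg (∑' k : d → ℤ, freqNormSq k ^ s *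
        ‖mFourierCoeff (EuclideanSpace.complexify ∘ u₀) k‖ ^ 2)
  exact (mul_le_mul_of_nonneg_right hG hX).trans hsmall

/-- **Global stability of the shear flow with numeric constants** (`G ≤ 125.5`, `K ≤ 83.5` in
`Torus.classicalNS_global_stability_shearWave_three`): with `|k| = (freqNormSq k)^{1/2}`,
`a₀ = |k|³‖A‖/√2`, `a₁ = |k|⁴‖A‖/√2`, `δ = ‖u₀ − A sin(2πk·x)‖₃`, the numeric condition
`125.5 · δ · exp((125.5 a₀ + 83.5 a₁)/(4π²|k|²ν)) < 4π²ν` gives a GLOBAL classical solution from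
`u₀` with the stability bound of the cited theorem (for `|k| = 1`: `125.5 δ e^{209‖A‖/(4√2π²ν)} < 4π²ν`).
[cite: Pizzocchero2021, Thm. 5.1, §6 (6.5)–(6.7); JonesIngham1925, Table I] -/
theorem Torus.classicalNS_global_stability_shearWave_three_numeric (hd : Fintype.card d = 3)
    {ν : ℝ} (hν : 0 < ν) {s : ℝ} (hs3 : s = 3) {k₀ : d → ℤ} (hk : k₀ ≠ 0)
    {A : EuclideanSpace ℝ d} (hA : ∑ j, (k₀ j : ℝ) * A j = 0)
    {u₀ : UnitAddTorus d → EuclideanSpace ℝ d} (hu₀ : Torus.IsSmooth u₀)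
    (hdiv : Torus.IsDivFree u₀) (hmean : Torus.HasZeroMean u₀)
    (hclose : 125.5 *
      Real.sqrt (∑' m : d → ℤ, freqNormSq m ^ s *
        ‖mFourierCoeff (EuclideanSpace.complexify ∘ (fun y => u₀ y - (mFourier k₀ y).im • A)) m‖ ^ 2) *
        Real.exp ((125.5 * (Real.sqrt (freqNormSq k₀) ^ s * ‖A‖ / Real.sqrt 2) +
          83.5 * (Real.sqrt (freqNormSq k₀) ^ (s + 1) * ‖A‖ / Real.sqrt 2)) /
            (ν * (4 * Real.pi ^ 2 * freqNormSq k₀))) <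
        4 * Real.pi ^ 2 * ν) :
    ∃ (u : ℝ → UnitAddTorus d → EuclideanSpace ℝ d) (p : ℝ → UnitAddTorus d → ℝ),
      Torus.IsClassicalNSSolutionOn (Ici 0) ν 0 u p ∧ u 0 = u₀ ∧
      (∀ t ∈ Ici (0 : ℝ), Torus.HasZeroMean (u t)) ∧
      ∀ t ∈ Ici (0 : ℝ), Real.sqrt (∑' m : d → ℤ, freqNormSq m ^ s *
        ‖mFourierCoeff (EuclideanSpace.complexify ∘
          (fun y => u t y - Real.exp (-(ν * (4 * Real.pi ^ 2 * freqNormSq k₀)) * t) • (mFourier k₀ y).im • A)) m‖ ^ 2) ≤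
        Real.sqrt (∑' m : d → ℤ, freqNormSq m ^ s *
          ‖mFourierCoeff (EuclideanSpace.complexify ∘ (fun y => u₀ y - (mFourier k₀ y).im • A)) m‖ ^ 2) *
          Real.exp ((2 * Real.pi * Real.sqrt (24 *
              ∑' m : d → ℤ, (if m = 0 then (0 : ℝ) else freqNormSq m ^ (-(s - 1)))) *
              (Real.sqrt (freqNormSq k₀) ^ s * ‖A‖ / Real.sqrt 2) +
            2 * Real.pi * Real.sqrt (((2 : ℝ) ^ (2 * s + 2) * (s + 1) ^ (s + 1) / (s + 2) ^ (s + 2)) *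
              ∑' m : d → ℤ, (if m = 0 then (0 : ℝ) else freqNormSq m ^ (-s))) *
              (Real.sqrt (freqNormSq k₀) ^ (s + 1) * ‖A‖ / Real.sqrt 2)) / (ν * (4 * Real.pi ^ 2 * freqNormSq k₀))) *
          Real.exp (-(4 * Real.pi ^ 2 * ν) * t) /
          (1 - 2 * Real.pi * Real.sqrt (24 *
              ∑' m : d → ℤ, (if m = 0 then (0 : ℝ) else freqNormSq m ^ (-(s - 1)))) *
            Real.sqrt (∑' m : d → ℤ, freqNormSq m ^ s *
              ‖mFourierCoeff (EuclideanSpace.complexify ∘ (fun y => u₀ y - (mFourier k₀ y).im • A)) m‖ ^ 2) *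
            Real.exp ((2 * Real.pi * Real.sqrt (24 *
                ∑' m : d → ℤ, (if m = 0 then (0 : ℝ) else freqNormSq m ^ (-(s - 1)))) *
                (Real.sqrt (freqNormSq k₀) ^ s * ‖A‖ / Real.sqrt 2) +
              2 * Real.pi * Real.sqrt (((2 : ℝ) ^ (2 * s + 2) * (s + 1) ^ (s + 1) / (s + 2) ^ (s + 2)) *
                ∑' m : d → ℤ, (if m = 0 then (0 : ℝ) else freqNormSq m ^ (-s))) *
                (Real.sqrt (freqNormSq k₀) ^ (s + 1) * ‖A‖ / Real.sqrt 2)) / (ν * (4 * Real.pi ^ 2 * freqNormSq k₀))) /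
            (4 * Real.pi ^ 2 * ν)) := by
  refine Torus.classicalNS_global_stability_shearWave_three hd hν hs3 hk hA hu₀ hdiv hmean ?_
  have hG := Torus.katoConst_three_le hd hs3
  have hK := Torus.transportConst_three_le hd hs3
  have hfr : 0 < freqNormSq k₀ := lt_of_lt_of_le one_pos (one_le_freqNormSq_of_ne_zero hk)
  exact za_mono_close hG hK (by positivity) (Real.sqrt_nonneg _) (by positivity) (by positivity)
    (by positivity) hclose

/-- **The `|k| = 1` census row, all constants numeric**: for a unit frequency `k` (`freqNormSq k = 1`,
i.e. `k = ±eᵢ`), `A ⊥ k`, and `δ = ‖u₀ − A sin(2πk·x)‖₃`, the condition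
`125.5 · δ · exp(209‖A‖/(4√2π²ν)) < 4π²ν` gives a GLOBAL classical solution from `u₀` with the
stability bound of `Torus.classicalNS_global_stability_shearWave_three` (`L = (G + K)‖A‖/(4√2π²ν)`,
`G + K ≤ 125.5 + 83.5 = 209`). [cite: Pizzocchero2021, Thm. 5.1, §6 (6.5)–(6.7); JonesIngham1925, Table I] -/
theorem Torus.classicalNS_global_stability_shearWave_three_unit (hd : Fintype.card d = 3)
    {ν : ℝ} (hν : 0 < ν) {s : ℝ} (hs3 : s = 3) {k₀ : d → ℤ} (hk1 : freqNormSq k₀ = 1)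
    {A : EuclideanSpace ℝ d} (hA : ∑ j, (k₀ j : ℝ) * A j = 0)
    {u₀ : UnitAddTorus d → EuclideanSpace ℝ d} (hu₀ : Torus.IsSmooth u₀)
    (hdiv : Torus.IsDivFree u₀) (hmean : Torus.HasZeroMean u₀)
    (hclose : 125.5 *
      Real.sqrt (∑' m : d → ℤ, freqNormSq m ^ s *
        ‖mFourierCoeff (EuclideanSpace.complexify ∘ (fun y => u₀ y - (mFourier k₀ y).im • A)) m‖ ^ 2) *
        Real.exp (209 * ‖A‖ / (4 * Real.sqrt 2 * Real.pi ^ 2 * ν)) < 4 * Real.pi ^ 2 * ν) :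
    ∃ (u : ℝ → UnitAddTorus d → EuclideanSpace ℝ d) (p : ℝ → UnitAddTorus d → ℝ),
      Torus.IsClassicalNSSolutionOn (Ici 0) ν 0 u p ∧ u 0 = u₀ ∧
      (∀ t ∈ Ici (0 : ℝ), Torus.HasZeroMean (u t)) ∧
      ∀ t ∈ Ici (0 : ℝ), Real.sqrt (∑' m : d → ℤ, freqNormSq m ^ s *
        ‖mFourierCoeff (EuclideanSpace.complexify ∘
          (fun y => u t y - Real.exp (-(ν * (4 * Real.pi ^ 2 * freqNormSq k₀)) * t) • (mFourier k₀ y).im • A)) m‖ ^ 2) ≤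
        Real.sqrt (∑' m : d → ℤ, freqNormSq m ^ s *
          ‖mFourierCoeff (EuclideanSpace.complexify ∘ (fun y => u₀ y - (mFourier k₀ y).im • A)) m‖ ^ 2) *
          Real.exp ((2 * Real.pi * Real.sqrt (24 *
              ∑' m : d → ℤ, (if m = 0 then (0 : ℝ) else freqNormSq m ^ (-(s - 1)))) *
              (Real.sqrt (freqNormSq k₀) ^ s * ‖A‖ / Real.sqrt 2) +
            2 * Real.pi * Real.sqrt (((2 : ℝ) ^ (2 * s + 2) * (s + 1) ^ (s + 1) / (s + 2) ^ (s + 2)) *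
              ∑' m : d → ℤ, (if m = 0 then (0 : ℝ) else freqNormSq m ^ (-s))) *
              (Real.sqrt (freqNormSq k₀) ^ (s + 1) * ‖A‖ / Real.sqrt 2)) / (ν * (4 * Real.pi ^ 2 * freqNormSq k₀))) *
          Real.exp (-(4 * Real.pi ^ 2 * ν) * t) /
          (1 - 2 * Real.pi * Real.sqrt (24 *
              ∑' m : d → ℤ, (if m = 0 then (0 : ℝ) else freqNormSq m ^ (-(s - 1)))) *
            Real.sqrt (∑' m : d → ℤ, freqNormSq m ^ s *
              ‖mFourierCoeff (EuclideanSpace.complexify ∘ (fun y => u₀ y - (mFourier k₀ y).im • A)) m‖ ^ 2) *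
            Real.exp ((2 * Real.pi * Real.sqrt (24 *
                ∑' m : d → ℤ, (if m = 0 then (0 : ℝ) else freqNormSq m ^ (-(s - 1)))) *
                (Real.sqrt (freqNormSq k₀) ^ s * ‖A‖ / Real.sqrt 2) +
              2 * Real.pi * Real.sqrt (((2 : ℝ) ^ (2 * s + 2) * (s + 1) ^ (s + 1) / (s + 2) ^ (s + 2)) *
                ∑' m : d → ℤ, (if m = 0 then (0 : ℝ) else freqNormSq m ^ (-s))) *
                (Real.sqrt (freqNormSq k₀) ^ (s + 1) * ‖A‖ / Real.sqrt 2)) / (ν * (4 * Real.pi ^ 2 * freqNormSq k₀))) /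
            (4 * Real.pi ^ 2 * ν)) := by
  have hk : k₀ ≠ 0 := by
    rintro rfl; rw [freqNormSq_zero] at hk1; exact zero_ne_one hk1
  refine Torus.classicalNS_global_stability_shearWave_three_numeric hd hν hs3 hk hA hu₀ hdiv hmean ?_
  rw [hk1, Real.sqrt_one, Real.one_rpow, Real.one_rpow]
  have h2 : (0 : ℝ) < Real.sqrt 2 := Real.sqrt_pos.2 (by norm_num)
  have hexp : (125.5 * (1 * ‖A‖ / Real.sqrt 2) + 83.5 * (1 * ‖A‖ / Real.sqrt 2)) /
      (ν * (4 * Real.pi ^ 2 * 1)) = 209 * ‖A‖ / (4 * Real.sqrt 2 * Real.pi ^ 2 * ν) := by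
    field_simp
    ring
  rw [hexp]
  exact hclose

end Lifespan

end Literature.Analysis.FluidPDE
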